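import Mathlib
import Literature.NumberTheory.Automorphic.FuchsianTorsion
import Literature.NumberTheory.Automorphic.FuchsianGroupCusps
import Literature.NumberTheory.Automorphic.MaassFormZeroMode

/-!
# Collars of short geodesics and the positive systole of a finite volume Fuchsian group
(Iwaniec, *Spectral Methods of Automorphic Forms*, GSM 53, §2.1–2.2 (Prop. 2.2–2.3), PDF pp. 27–29;
Beardon, *The Geometry of Discrete Groups*, GTM 91, Thm 5.4.1 (Jørgensen) and §11.6 (collars);
Jørgensen, Amer. J. Math. 98 (1976), Lemma 1)

Fifth brick of the theory of a GENERAL discrete `Γ ≤ SL₂(ℝ)` (after `FuchsianGroupCusps`,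
`FuchsianCuspZones`, `JorgensenInequality`, `FuchsianTorsion`), second half of the thick–thin route to
the compactness of the central part of a fundamental domain of finite volume (Siegel's theorem;
Iwaniec's Prop. 2.3–2.5, stated there without proof): the hyperbolic elements. **If `Γ` has a
measurable fundamental domain of finite hyperbolic area then its hyperbolic elements have
`tr²γ - 4 = 4 sinh²(ℓ_γ/2) ≥ η > 0` uniformly** (`exists_pos_le_traceSq_sub_four`): there are no
arbitrarily short closed geodesics. In the book this is contained in Prop. 2.3 (finite volume ⇒
finitely generated of the first kind); here it is PROVED, without fundamental polygons, by the collar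
argument: a short hyperbolic element has a wide precisely invariant collar about its axis
(Jørgensen's inequality), collars of inequivalent short axes are disjoint (Jørgensen again), a test
disc in each collar embeds in `Γ\ℍ` up to `±1`, and unfolding against the fundamental domain bounds
the number of classes by `|F|/(4πρ₀)`. Everything is proved; nothing is vendored; no fact is
introduced.

1. (§1) `exists_conj_diag`: a hyperbolic `γ ∈ SL₂(ℝ)` (`tr²γ > 4`) is conjugate to a diagonal
   `D = g⁻¹γg`, `(D₀₀)² ≠ 1` (frame of the axis).
2. (§2) The collar `collar σ = {|Re z| ≤ σ Im z}` about `iℝ₊` and its fundamental piece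
   `collarPiece σ q = collar σ ∩ {1 ≤ Im z < q}` for the dilation `z ↦ qz`, of area `2σ log q`
   (`volume_collarPiece`); `coe_diag_smul` (`Dz = D₀₀² z`) and the displacement
   `u(z, Dz) = ¼(tr²D - 4)(1 + (Re z/Im z)²)` (`pointPairInv_diag_smul`).
3. (§3) The isometry identity `|Bz - m|² - r² = -2r (Re z/Im z) Im Bz` for the image geodesic
   `B(iℝ₊) = (b/d, a/c)` (`normSq_sub_center_sub_radius_sq`), the frame-change estimate
   `|bc| ≤ 1 + (σ₁ + σ₂)(σ₂ + √(σ₂²+1))/2` when `B` maps a point of `collar σ₂` into `collar σ₁`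
   (`abs_mul_le_of_collars`), and the **collar lemma** (`collar_precisely_invariant`): in a discrete
   `Γ' ∋ D = diag`, `μ = tr²D - 4`, if `μ(3 + 3σ²) < 1` then an element mapping a point of `collar σ`
   into `collar σ` is diagonal or antidiagonal (Jørgensen, `jorgensen_hyperbolic_diag`).
4. (§4) `cross_collar`: if moreover `H = gD₂g⁻¹ ∈ Γ'` is hyperbolic and the collars `collar σ₁`,
   `g collar σ₂` meet (`1 ≤ σ₂ ≤ σ₁`, `μ₁(1 + 20(σ₁σ₂)²μ₂) < 1`), then `g` is diagonal or
   antidiagonal: the axes coincide.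
5. (§5) Axis data (`AxisData Γ g D`: `gDg⁻¹ ∈ Γ`, `D` diagonal, `μ_D ≤ 1/64`, `μ_D` minimal among the
   diagonal elements of `g⁻¹Γg`), widths `σ = √((1/64)/μ)`, test discs
   `axisDisc g D = g{u(σ/2 + i, ·) ≤ ρ₀}`, `ρ₀ = 1/5000`, inside the collar
   (`uDisc_basePt_subset_collar`); displacement bounds at the base point for dilations
   (`≥ μσ²/16`) and half-turns (`≥ (Re/Im)²`); **hits in one class come from `±γ`**
   (`eq_or_eq_neg_of_mem_axisDisc`), **discs of data with different `μ` are never hit together**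
   (`mu_eq_of_mem_axisDisc`), multiplicity `≤ 2` (`tsum_axisWeight_le_two`), the unfolding count
   `N · 4πρ₀ ≤ |F|` (`card_axisData_le`), existence of axis data below any short hyperbolic element
   (`exists_axisData`), and the positive systole `exists_pos_le_traceSq_sub_four`.

## References
* [Iwaniec2002] H. Iwaniec, *Spectral Methods of Automorphic Forms*, 2nd ed., GSM 53, AMS 2002,
  §2.1–2.2, PDF pp. 27–29.
* [Beardon1983] A. F. Beardon, *The Geometry of Discrete Groups*, GTM 91, Springer 1983, Thm 5.4.1.
* [Jorgensen1976] T. Jørgensen, On discrete groups of Möbius transformations, Amer. J. Math. 98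
  (1976), 739–749, Lemma 1.

Mathlib: `Real.sqrt`, `MeasureTheory.lintegral_prod_symm`, `integral_inv`, `Set.encard`,
`Finset.exists_min_image`. Literature: `jorgensen_hyperbolic_diag`, `jorgensenJ_diag_eq`,
`conj_diag_apply`, `apply_01_eq_zero_of_upper`, `apply_10_eq_zero_of_lower`,
`diag_or_antidiag_of_conj_eq`, `conj_eq_or_eq_inv_of_diag`, `trace_conj_eq`, `inv_apply_fin_two`
(`JorgensenInequality.lean`); `uDisc`, `volume_uDisc`, `smul_uDisc` (`FuchsianTorsion.lean`);
`IsDiscreteSubgroup.conj`, `conj_le_range`, `mem_conj_inv_iff`, `isDiscreteSubgroup_iff_finite_abs_le`,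
`translSL` (`FuchsianGroupCusps.lean`); `pointPairInv_le_of_le_of_le` (`LocalWeylLaw.lean`);
`setLIntegral_tsum_smul_eq` (`FundamentalDomainUnfolding.lean`); `setLIntegral_upperHalfPlane`
(`MaassFormZeroMode.lean`). Nothing on collars, translation lengths or systoles of Fuchsian groups
existed (`lean search 'collar|systole|translation length|hyperbolic element'`).
-/

noncomputable section

namespace Literature.NumberTheory.Automorphic

namespace Fuchsian

open Matrix UpperHalfPlane _root_.MeasureTheory _root_.Set
open scoped _root_.MatrixGroups _root_.Pointwise _root_.ENNReal _root_.NNReal _root_.Real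

variable {Γ : Subgroup (GL (Fin 2) ℝ)} {F : Set ℍ}

/-! ## 1. The frame of a hyperbolic element -/

section Frame

/-- Entries of a triple product `X * γ * Y` in `SL₂(ℝ)` (as real numbers). [folklore] -/
theorem triple_apply (X γ Y : SL(2, ℝ)) (i j : Fin 2) :
    (X * γ * Y) i j = (X i 0 * γ 0 0 + X i 1 * γ 1 0) * Y 0 j + (X i 0 * γ 0 1 + X i 1 * γ 1 1) * Y 1 j := by
  simp [Matrix.SpecialLinearGroup.coe_mul, Matrix.mul_apply, Fin.sum_univ_two]

/-- **Diagonalising a hyperbolic element.** If `γ ∈ SL₂(ℝ)` has `tr²γ > 4` then some `g ∈ SL₂(ℝ)`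
conjugates it to a diagonal matrix `g⁻¹γg = diag(l, l⁻¹)`, `l² ≠ 1` (the columns of `g` point to
the two fixed points of `γ` on `ℝ ∪ {∞}`, the endpoints of its axis; Iwaniec §1.5: a hyperbolic
motion is conjugate to a dilation `z ↦ pz`). [cite: Iwaniec2002, §1.5, PDF pp. 19–20] -/
theorem exists_conj_diag (γ : SL(2, ℝ)) (hγ : 4 < (γ 0 0 + γ 1 1) ^ 2) :
    ∃ g : SL(2, ℝ), (g⁻¹ * γ * g) 0 1 = 0 ∧ (g⁻¹ * γ * g) 1 0 = 0 ∧ (g⁻¹ * γ * g) 0 0 ^ 2 ≠ 1 := by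
  have hdet := det_rel γ
  have hdisc : 0 < (γ 1 1 - γ 0 0) ^ 2 + 4 * γ 0 1 * γ 1 0 := by nlinarith
  -- diagonal conjugates have the trace of `γ`, hence `l² ≠ 1`
  have htr : ∀ g : SL(2, ℝ), (g⁻¹ * γ * g) 0 1 = 0 → (g⁻¹ * γ * g) 0 0 ^ 2 ≠ 1 := by
    intro g h01 hsq
    have ht := trace_conj_eq g γ
    have hd1 := diag_mul_eq_one h01
    have key : ((g⁻¹ * γ * g) 0 0 + (g⁻¹ * γ * g) 1 1) ^ 2 = 4 := by
      rcases sq_eq_one_iff.mp hsq with hl | hl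
      · rw [hl, one_mul] at hd1; rw [hl, hd1]; norm_num
      · rw [hl] at hd1
        have h11 : (g⁻¹ * γ * g) 1 1 = -1 := by linarith
        rw [hl, h11]; norm_num
    rw [ht] at key
    linarith
  by_cases hc0 : γ 1 0 = 0
  · -- triangular: fixed points `∞` and `x₀ = b/(d - a)`; conjugate by the translation `T_{x₀}`
    have had : γ 1 1 - γ 0 0 ≠ 0 := by
      intro h
      have : (γ 1 1 - γ 0 0) ^ 2 + 4 * γ 0 1 * γ 1 0 = 0 := by rw [h, hc0]; ring
      linarith
    set x₀ : ℝ := γ 0 1 / (γ 1 1 - γ 0 0) with hx₀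
    have hx₀' : x₀ * (γ 1 1 - γ 0 0) = γ 0 1 := by rw [hx₀]; field_simp
    obtain ⟨i00, i01, i10, i11⟩ := inv_apply_fin_two (translSL x₀)
    have h01 : ((translSL x₀)⁻¹ * γ * translSL x₀) 0 1 = 0 := by
      rw [triple_apply, i00, i01]
      simp only [translSL_apply_01, translSL_apply_11]
      rw [hc0]
      linear_combination (-1 : ℝ) * hx₀'
    have h10 : ((translSL x₀)⁻¹ * γ * translSL x₀) 1 0 = 0 := by
      rw [triple_apply, i10, i11]
      simp only [translSL_apply_00, translSL_apply_10]
      rw [hc0]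
      ring
    exact ⟨translSL x₀, h01, h10, htr _ h01⟩
  · -- two finite fixed points, the roots of `c x² + (d - a) x - b`
    set s : ℝ := Real.sqrt ((γ 1 1 - γ 0 0) ^ 2 + 4 * γ 0 1 * γ 1 0) with hs
    have hs0 : 0 < s := Real.sqrt_pos.mpr hdisc
    have hs2 : s ^ 2 = (γ 1 1 - γ 0 0) ^ 2 + 4 * γ 0 1 * γ 1 0 := Real.sq_sqrt hdisc.le
    set x₁ : ℝ := (γ 0 0 - γ 1 1 + s) / (2 * γ 1 0) with hx₁
    set x₂ : ℝ := (γ 0 0 - γ 1 1 - s) / (2 * γ 1 0) with hx₂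
    have r₁ : γ 1 0 * x₁ ^ 2 + (γ 1 1 - γ 0 0) * x₁ - γ 0 1 = 0 := by
      rw [hx₁]; field_simp; nlinarith [hs2]
    have r₂ : γ 1 0 * x₂ ^ 2 + (γ 1 1 - γ 0 0) * x₂ - γ 0 1 = 0 := by
      rw [hx₂]; field_simp; nlinarith [hs2]
    have hdiff : x₁ - x₂ = s / γ 1 0 := by rw [hx₁, hx₂]; field_simp; ring
    have hne0 : x₁ - x₂ ≠ 0 := by rw [hdiff]; exact div_ne_zero hs0.ne' hc0
    set κ : ℝ := 1 / (x₁ - x₂) with hκ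
    have hκ' : κ * (x₁ - x₂) = 1 := by rw [hκ]; field_simp
    -- the frame `g₀ = (x₁, x₂κ; 1, κ)`: `g₀ ∞ = x₁`, `g₀ 0 = x₂`
    set g₀ : Matrix (Fin 2) (Fin 2) ℝ := !![x₁, x₂ * κ; 1, κ] with hg₀
    have hg₀det : g₀.det = 1 := by
      rw [hg₀, Matrix.det_fin_two_of]; linear_combination hκ'
    set g : SL(2, ℝ) := ⟨g₀, hg₀det⟩ with hg
    have e00 : g 0 0 = x₁ := rfl
    have e01 : g 0 1 = x₂ * κ := rfl
    have e10 : g 1 0 = 1 := rfl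
    have e11 : g 1 1 = κ := rfl
    obtain ⟨i00, i01, i10, i11⟩ := inv_apply_fin_two g
    have h01 : (g⁻¹ * γ * g) 0 1 = 0 := by
      rw [triple_apply]
      simp only [i00, i01, e01, e11]
      linear_combination (-(κ ^ 2)) * r₂
    have h10 : (g⁻¹ * γ * g) 1 0 = 0 := by
      rw [triple_apply]
      simp only [i10, i11, e00, e10]
      linear_combination r₁
    exact ⟨g, h01, h10, htr _ h01⟩

end Frame

/-! ## 2. The collar about the imaginary axis, its fundamental piece and the displacement -/

section Collar

/-- The collar `{|Re z| ≤ σ Im z}` about the imaginary axis (`sinh ρ(z, iℝ₊) = |Re z|/Im z ≤ σ`).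
[cite: Beardon1983, Thm 5.4.1] -/
def collar (σ : ℝ) : Set ℍ := {z | |z.re| ≤ σ * z.im}

/-- Membership in the collar. [folklore] -/
theorem mem_collar_iff {σ : ℝ} {z : ℍ} : z ∈ collar σ ↔ |z.re| ≤ σ * z.im := Iff.rfl

/-- The fundamental piece `{|Re z| ≤ σ Im z, 1 ≤ Im z < q}` of the collar for the dilation `z ↦ qz`
(the horizontal strip `{1 ≤ Im z < q}` is a fundamental domain of `⟨z ↦ qz⟩`). [folklore] -/
def collarPiece (σ q : ℝ) : Set ℍ := {z | |z.re| ≤ σ * z.im ∧ 1 ≤ z.im ∧ z.im < q}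

/-- Membership in the fundamental piece. [folklore] -/
theorem mem_collarPiece_iff {σ q : ℝ} {z : ℍ} :
    z ∈ collarPiece σ q ↔ |z.re| ≤ σ * z.im ∧ 1 ≤ z.im ∧ z.im < q := Iff.rfl

/-- The fundamental piece lies in the collar. [folklore] -/
theorem collarPiece_subset_collar (σ q : ℝ) : collarPiece σ q ⊆ collar σ := fun _ h => h.1

/-- The fundamental piece is measurable. [folklore] -/
theorem measurableSet_collarPiece (σ q : ℝ) : MeasurableSet (collarPiece σ q) := by
  have hre : Measurable fun w : ℍ => w.re := UpperHalfPlane.continuous_re.measurable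
  have him : Measurable fun w : ℍ => w.im := UpperHalfPlane.continuous_im.measurable
  refine (measurableSet_le hre.abs (measurable_const.mul him)).inter
    ((measurableSet_le measurable_const him).inter (measurableSet_lt him measurable_const))

/-- The image of the fundamental piece in `ℂ`. [folklore] -/
theorem image_coe_collarPiece (σ q : ℝ) :
    ((↑) '' collarPiece σ q : Set ℂ) = {z : ℂ | |z.re| ≤ σ * z.im ∧ 1 ≤ z.im ∧ z.im < q} := by
  ext z
  constructor
  · rintro ⟨w, ⟨h0, h1, h2⟩, rfl⟩
    exact ⟨h0, h1, h2⟩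
  · rintro ⟨h0, h1, h2⟩
    have hz : 0 < z.im := lt_of_lt_of_le one_pos h1
    exact ⟨⟨z, hz⟩, ⟨h0, h1, h2⟩, rfl⟩

/-- **The area of the fundamental piece of the collar**:
`|{|x| ≤ σy, 1 ≤ y < q}| = ∫_1^q 2σy · y⁻² dy = 2σ log q`. [folklore] -/
theorem volume_collarPiece {σ q : ℝ} (hσ : 0 ≤ σ) (hq : 1 ≤ q) :
    volume (collarPiece σ q) = ENNReal.ofReal (2 * σ * Real.log q) := by
  rw [← setLIntegral_one, setLIntegral_upperHalfPlane (fun _ => 1) measurable_const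
    (measurableSet_collarPiece σ q), image_coe_collarPiece]
  simp only [one_mul]
  -- to `ℝ × ℝ`, integrating first in `x`
  have hmp := Complex.volume_preserving_equiv_real_prod
  have hme := Complex.measurableEquivRealProd.measurableEmbedding
  set S : Set (ℝ × ℝ) := {p | |p.1| ≤ σ * p.2 ∧ 1 ≤ p.2 ∧ p.2 < q} with hS
  have hset : {z : ℂ | |z.re| ≤ σ * z.im ∧ 1 ≤ z.im ∧ z.im < q} = Complex.measurableEquivRealProd ⁻¹' S := by
    ext z; simp [hS, Complex.measurableEquivRealProd_apply]
  have hSm : MeasurableSet S := by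
    refine (measurableSet_le measurable_fst.abs (measurable_const.mul measurable_snd)).inter
      ((measurableSet_le measurable_const measurable_snd).inter (measurableSet_lt measurable_snd measurable_const))
  set G : ℝ × ℝ → ℝ≥0∞ := fun p => S.indicator (fun p => (((1 / ‖p.2‖₊) ^ 2 : ℝ≥0) : ℝ≥0∞)) p with hG
  have hGm : Measurable G := by
    refine Measurable.indicator ?_ hSm
    refine ENNReal.continuous_coe.measurable.comp ?_
    exact ((measurable_const.div (measurable_snd.nnnorm)).pow_const 2)
  have h1 : ∫⁻ z in Complex.measurableEquivRealProd ⁻¹' S, (((1 / ‖z.im‖₊) ^ 2 : ℝ≥0) : ℝ≥0∞) = ∫⁻ p, G p := by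
    have h := hmp.setLIntegral_comp_preimage_emb hme (fun p : ℝ × ℝ => (((1 / ‖p.2‖₊) ^ 2 : ℝ≥0) : ℝ≥0∞)) S
    rw [← lintegral_indicator hSm] at h
    simpa [hG, Complex.measurableEquivRealProd_apply] using h
  rw [hset, h1, Measure.volume_eq_prod, lintegral_prod_symm _ hGm.aemeasurable]
  -- the inner integral in `x`
  have hinner : ∀ y : ℝ, ∫⁻ x, G (x, y) = (Ico (1 : ℝ) q).indicator
      (fun y => ENNReal.ofReal (2 * σ * y) * (((1 / ‖y‖₊) ^ 2 : ℝ≥0) : ℝ≥0∞)) y := by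
    intro y
    by_cases hy : y ∈ Ico (1 : ℝ) q
    · rw [Set.indicator_of_mem hy]
      have hy0 : 0 < y := lt_of_lt_of_le one_pos hy.1
      have e : (fun x => G (x, y)) = (Icc (-(σ * y)) (σ * y)).indicator
          (fun _ => (((1 / ‖y‖₊) ^ 2 : ℝ≥0) : ℝ≥0∞)) := by
        funext x
        simp only [hG, hS, Set.indicator, Set.mem_setOf_eq, Set.mem_Icc, abs_le]
        by_cases hx : -(σ * y) ≤ x ∧ x ≤ σ * y
        · rw [if_pos ⟨hx, hy.1, hy.2⟩, if_pos hx]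
        · rw [if_neg (fun h => hx h.1), if_neg hx]
      rw [e, lintegral_indicator_const measurableSet_Icc, Real.volume_Icc, mul_comm]
      congr 1
      congr 1
      ring
    · rw [Set.indicator_of_notMem hy]
      have e : (fun x => G (x, y)) = fun _ => 0 := by
        funext x
        simp only [hG, hS, Set.indicator, Set.mem_setOf_eq]
        rw [if_neg]
        intro h
        exact hy ⟨h.2.1, h.2.2⟩
      rw [e, lintegral_zero]
  simp_rw [hinner]
  rw [lintegral_indicator measurableSet_Ico]
  -- `∫_1^q 2σ y · y⁻² = 2σ log q`
  have e2 : ∀ y ∈ Ico (1 : ℝ) q, ENNReal.ofReal (2 * σ * y) * (((1 / ‖y‖₊) ^ 2 : ℝ≥0) : ℝ≥0∞) =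
      ENNReal.ofReal (2 * σ * y⁻¹) := by
    intro y hy
    have hy0 : 0 < y := lt_of_lt_of_le one_pos hy.1
    have ec : (((1 / ‖y‖₊) ^ 2 : ℝ≥0) : ℝ≥0∞) = ENNReal.ofReal ((y ^ 2)⁻¹) := by
      rw [ENNReal.ofReal, ENNReal.coe_inj]
      apply NNReal.eq
      rw [Real.coe_toNNReal _ (by positivity)]
      simp [NNReal.coe_pow, Real.nnnorm_of_nonneg hy0.le]
    rw [ec, ← ENNReal.ofReal_mul (by positivity)]
    congr 1
    field_simp
  rw [setLIntegral_congr_fun measurableSet_Ico e2]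
  have hint : IntegrableOn (fun y : ℝ => 2 * σ * y⁻¹) (Ico (1 : ℝ) q) := by
    have hc : ContinuousOn (fun y : ℝ => 2 * σ * y⁻¹) (Icc (1 : ℝ) q) := by
      apply ContinuousOn.mul continuousOn_const
      exact continuousOn_inv₀.mono fun y hy => (lt_of_lt_of_le one_pos hy.1).ne'
    exact (hc.integrableOn_Icc).mono_set Ico_subset_Icc_self
  have hnn : 0 ≤ᵐ[volume.restrict (Ico (1 : ℝ) q)] fun y : ℝ => 2 * σ * y⁻¹ :=
    (ae_restrict_iff' measurableSet_Ico).mpr (Filter.Eventually.of_forall fun y hy => by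
      have : 0 < y := lt_of_lt_of_le one_pos hy.1
      positivity)
  rw [← ofReal_integral_eq_lintegral_ofReal hint hnn]
  congr 1
  rw [integral_Ico_eq_integral_Ioc, ← intervalIntegral.integral_of_le hq,
    intervalIntegral.integral_const_mul]
  have : ∫ y in (1 : ℝ)..q, y⁻¹ = Real.log q := by
    rw [integral_inv (by
      rw [Set.uIcc_of_le hq]
      intro h
      exact absurd h.1 (by norm_num))]
    simp
  rw [this]

/-- The dilation `D = diag(l, l⁻¹)` acts by `z ↦ l² z`. [cite: Iwaniec2002, §1.2, PDF p. 12] -/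
theorem coe_diag_smul {D : SL(2, ℝ)} (h01 : D 0 1 = 0) (h10 : D 1 0 = 0) (z : ℍ) :
    ((D • z : ℍ) : ℂ) = ((D 0 0 ^ 2 : ℝ) : ℂ) * (z : ℂ) := by
  have hd := diag_mul_eq_one h01
  have h11 : ((D 1 1 : ℝ) : ℂ) ≠ 0 := by
    intro h
    have : (D 1 1 : ℝ) = 0 := by exact_mod_cast h
    rw [this, mul_zero] at hd
    exact zero_ne_one hd
  have hmul : ((D 0 0 : ℝ) : ℂ) * ((D 1 1 : ℝ) : ℂ) = 1 := by exact_mod_cast hd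
  rw [UpperHalfPlane.coe_specialLinearGroup_apply]
  simp only [h01, h10]
  simp only [Algebra.algebraMap_self, RingHom.id_apply, Complex.ofReal_zero, zero_mul, add_zero,
    zero_add]
  rw [div_eq_iff h11]
  push_cast
  linear_combination (-((D 0 0 : ℝ) : ℂ) * (z : ℂ)) * hmul

/-- **The displacement of the dilation**: `u(z, Dz) = ¼ (tr²D - 4)(1 + (Re z/Im z)²)`
(`sinh(ρ(z, Dz)/2) = sinh(ℓ/2) cosh ρ(z, axis)`, `tr²D - 4 = 4 sinh²(ℓ/2)`). [cite: Beardon1983, Thm 5.4.1] -/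
theorem pointPairInv_diag_smul {D : SL(2, ℝ)} (h01 : D 0 1 = 0) (h10 : D 1 0 = 0) (z : ℍ) :
    pointPairInv z (D • z) = ((D 0 0 + D 1 1) ^ 2 - 4) * (1 + (z.re / z.im) ^ 2) / 4 := by
  have hd := diag_mul_eq_one h01
  have htr := trace_sq_diag_sub_four h01
  have him : (D • z).im = D 0 0 ^ 2 * z.im := by
    have := congrArg Complex.im (coe_diag_smul h01 h10 z)
    rw [Complex.im_ofReal_mul] at this
    simpa using this
  have hre : (D • z).re = D 0 0 ^ 2 * z.re := by
    have := congrArg Complex.re (coe_diag_smul h01 h10 z)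
    rw [Complex.re_ofReal_mul] at this
    simpa using this
  rw [pointPairInv, Complex.dist_eq, Complex.sq_norm, Complex.normSq_apply]
  simp only [Complex.sub_re, Complex.sub_im, UpperHalfPlane.coe_re, UpperHalfPlane.coe_im, hre, him]
  have hy : z.im ≠ 0 := z.im_ne_zero
  have hl : D 0 0 ≠ 0 := fun h => by rw [h, zero_mul] at hd; exact zero_ne_one hd
  rw [htr]
  have e11 : D 1 1 = (D 0 0)⁻¹ := by field_simp; linarith
  rw [e11]
  field_simp
  ring

end Collar

/-! ## 3. Precise invariance of the collar under the stabiliser of the axis -/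

section Invariance

/-- **The isometry identity behind the collar lemma.** For `B = (a b; c d) ∈ SL₂(ℝ)` with `cd ≠ 0`,
the image geodesic `B(iℝ₊)` has endpoints `e₁ = b/d`, `e₂ = a/c`, centre `m` and signed radius
`r = (e₂ - e₁)/2 = 1/(2cd)`, and for `w = Bz`:
`|w - m|² - r² = -2r (Re z/Im z) Im w` — the signed `sinh`-distance of `w` to `B(iℝ₊)` is that of
`z` to `iℝ₊`. [folklore] -/
theorem normSq_sub_center_sub_radius_sq (B : SL(2, ℝ)) (hc : B 1 0 ≠ 0) (hd : B 1 1 ≠ 0) (z : ℍ) :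
    ((B • z).re - (B 0 1 / B 1 1 + B 0 0 / B 1 0) / 2) ^ 2 + (B • z).im ^ 2 - (1 / (2 * (B 1 0 * B 1 1))) ^ 2 =
      -2 * (1 / (2 * (B 1 0 * B 1 1))) * (z.re / z.im) * (B • z).im := by
  have hdet := det_rel B
  -- real and imaginary parts of `w = Bz`
  set N : ℝ := Complex.normSq (UpperHalfPlane.denom (Matrix.SpecialLinearGroup.toGL B : GL (Fin 2) ℝ) z) with hN
  have hN0 : 0 < N := UpperHalfPlane.normSq_denom_pos _ z.im_ne_zero
  have hden : UpperHalfPlane.denom (Matrix.SpecialLinearGroup.toGL B : GL (Fin 2) ℝ) z =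
      (B 1 0 : ℂ) * (z : ℂ) + B 1 1 := rfl
  have hNval : N = (B 1 0 * z.re + B 1 1) ^ 2 + (B 1 0 * z.im) ^ 2 := by
    rw [hN, hden, Complex.normSq_apply]
    simp only [Complex.add_re, Complex.mul_re, Complex.ofReal_re, Complex.ofReal_im, zero_mul, sub_zero,
      UpperHalfPlane.coe_re, UpperHalfPlane.coe_im, Complex.add_im, Complex.mul_im, add_zero]
    ring
  have him : (B • z).im = z.im / N := by
    have := UpperHalfPlane.im_smul_eq_div_normSq (Matrix.SpecialLinearGroup.toGL B : GL (Fin 2) ℝ) z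
    show ((Matrix.SpecialLinearGroup.toGL B : GL (Fin 2) ℝ) • z).im = z.im / N
    rw [this, hN]
    simp
  have hre : (B • z).re = ((B 0 0 * z.re + B 0 1) * (B 1 0 * z.re + B 1 1) + B 0 0 * B 1 0 * z.im ^ 2) / N := by
    have e : ((B • z : ℍ) : ℂ) = ((B 0 0 : ℂ) * z + B 0 1) / ((B 1 0 : ℂ) * z + B 1 1) := by
      rw [UpperHalfPlane.coe_specialLinearGroup_apply]
      simp only [Algebra.algebraMap_self, RingHom.id_apply]
    have := congrArg Complex.re e
    rw [UpperHalfPlane.coe_re, Complex.div_re] at this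
    rw [this, ← hden, ← hN]
    simp only [Complex.add_re, Complex.mul_re, Complex.ofReal_re, Complex.ofReal_im, zero_mul, sub_zero,
      UpperHalfPlane.coe_re, UpperHalfPlane.coe_im, Complex.add_im, Complex.mul_im, add_zero, hden]
    field_simp
  rw [hre, him]
  have hy : z.im ≠ 0 := z.im_ne_zero
  rw [hNval]
  have hNval0 : (B 1 0 * z.re + B 1 1) ^ 2 + (B 1 0 * z.im) ^ 2 ≠ 0 := by rw [← hNval]; exact hN0.ne'
  -- eliminate `a = (1 + bc)/d`; the identity is then unconditional
  have ha : B 0 0 = (1 + B 0 1 * B 1 0) / B 1 1 := by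
    field_simp
    linarith
  rw [ha]
  field_simp
  ring

/-- `D 0 0 ≠ D 1 1` for a diagonal `D` with `(D 0 0)² ≠ 1`. [folklore] -/
theorem diag_ne_of_sq_ne_one {D : SL(2, ℝ)} (h01 : D 0 1 = 0) (hl : D 0 0 ^ 2 ≠ 1) : D 0 0 ≠ D 1 1 := by
  intro h
  have := diag_mul_eq_one h01
  rw [← h, ← sq] at this
  exact hl this

/-- An element of `Γ'` with a vanishing entry, where `Γ'` is discrete and contains the diagonal
`D`, preserves the pair `{0, ∞}`: it is diagonal or antidiagonal (the conjugate `BDB⁻¹` is then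
triangular, hence diagonal by discreteness, hence `B` normalises `D`). [cite: Beardon1983, Thm 5.4.1] -/
theorem diag_or_antidiag_of_entry_eq_zero
    (hΓ : Γ ≤ (Matrix.SpecialLinearGroup.toGL : SL(2, ℝ) →* GL (Fin 2) ℝ).range)
    (hd : IsDiscreteSubgroup Γ) {D B : SL(2, ℝ)}
    (hD : (Matrix.SpecialLinearGroup.toGL D : GL (Fin 2) ℝ) ∈ Γ)
    (hB : (Matrix.SpecialLinearGroup.toGL B : GL (Fin 2) ℝ) ∈ Γ)
    (h01 : D 0 1 = 0) (h10 : D 1 0 = 0) (hl : D 0 0 ^ 2 ≠ 1)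
    (h0 : B 0 0 = 0 ∨ B 0 1 = 0 ∨ B 1 0 = 0 ∨ B 1 1 = 0) :
    (B 0 1 = 0 ∧ B 1 0 = 0) ∨ (B 0 0 = 0 ∧ B 1 1 = 0) := by
  have hlm := diag_ne_of_sq_ne_one h01 hl
  have hC : (Matrix.SpecialLinearGroup.toGL (B * D * B⁻¹) : GL (Fin 2) ℝ) ∈ Γ := by
    rw [map_mul, map_mul, map_inv]
    exact Γ.mul_mem (Γ.mul_mem hB hD) (Γ.inv_mem hB)
  obtain ⟨-, c01, c10, -⟩ := conj_diag_apply h01 h10 B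
  rcases h0 with h | h | h | h
  · -- `a = 0`: `BDB⁻¹` is lower triangular
    have hC01 : (B * D * B⁻¹) 0 1 = 0 := by rw [c01, h]; ring
    have hC10 := apply_10_eq_zero_of_lower hΓ hd hD hC h01 h10 hl hC01
    exact diag_or_antidiag_of_conj_eq h01 h10 hlm (conj_eq_or_eq_inv_of_diag h01 h10 hC01 hC10)
  · left
    exact ⟨h, apply_10_eq_zero_of_lower hΓ hd hD hB h01 h10 hl h⟩
  · left
    exact ⟨apply_01_eq_zero_of_upper hΓ hd hD hB h01 h10 hl h, h⟩
  · -- `d = 0`: `BDB⁻¹` is upper triangular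
    have hC10 : (B * D * B⁻¹) 1 0 = 0 := by rw [c10, h]; ring
    have hC01 := apply_01_eq_zero_of_upper hΓ hd hD hC h01 h10 hl hC10
    exact diag_or_antidiag_of_conj_eq h01 h10 hlm (conj_eq_or_eq_inv_of_diag h01 h10 hC01 hC10)

/-- **The frame-change estimate.** If `B = (a b; c d) ∈ SL₂(ℝ)`, `cd ≠ 0`, maps a point `z` with
`|Re z| ≤ σ₂ Im z` to `w = Bz` with `|Re w| ≤ σ₁ Im w` (`σᵢ ≥ 0`), then
`|bc| ≤ 1 + (σ₁ + σ₂)(σ₂ + √(σ₂² + 1))/2`: by the isometry identity the image geodesic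
`B(iℝ₊) = (e₁, e₂)` (centre `m`, radius `|r|`, `|bc| = |e₁|/2|r|`) satisfies `||w - m|² - r²| ≤ 2|r|σ₂ Im w`,
whence `Im w ≤ |r|(σ₂ + √(σ₂²+1))`, `|Re w - m| ≤ |r|(1 + σ₂E₂)` and `|e₁| ≤ |m| + |r|`. [folklore] -/
theorem abs_mul_le_of_collars (B : SL(2, ℝ)) (hc : B 1 0 ≠ 0) (hdd : B 1 1 ≠ 0) {σ₁ σ₂ : ℝ}
    (hσ₁ : 0 ≤ σ₁) (hσ₂ : 0 ≤ σ₂) {z : ℍ} (hz : |z.re| ≤ σ₂ * z.im) (hBz : |(B • z).re| ≤ σ₁ * (B • z).im) :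
    |B 0 1 * B 1 0| ≤ 1 + (σ₁ + σ₂) * (σ₂ + Real.sqrt (σ₂ ^ 2 + 1)) / 2 := by
  have hdet := det_rel B
  have hzz : |z.re / z.im| ≤ σ₂ := by
    rw [abs_div, abs_of_pos z.im_pos, div_le_iff₀ z.im_pos]; exact hz
  have hid := normSq_sub_center_sub_radius_sq B hc hdd z
  have hv0 : 0 < (B • z).im := (B • z).im_pos
  generalize hw : B • z = w at hBz hid hv0
  generalize ht : z.re / z.im = t at hzz hid
  -- notation
  set v : ℝ := w.im with hv
  set r : ℝ := 1 / (2 * (B 1 0 * B 1 1)) with hr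
  set m : ℝ := (B 0 1 / B 1 1 + B 0 0 / B 1 0) / 2 with hm
  have hcd : B 1 0 * B 1 1 ≠ 0 := mul_ne_zero hc hdd
  have hr0 : r ≠ 0 := by rw [hr]; exact div_ne_zero one_ne_zero (mul_ne_zero two_ne_zero hcd)
  have hR : 0 < |r| := abs_pos.mpr hr0
  -- `||w - m|² - r²| ≤ 2 |r| σ₂ v`
  have hA : |(w.re - m) ^ 2 + v ^ 2 - r ^ 2| ≤ 2 * |r| * σ₂ * v := by
    rw [hid, show -2 * r * t * v = -(2 * (r * t) * v) by ring, abs_neg, abs_mul, abs_mul, abs_of_pos hv0,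
      abs_mul, abs_two]
    have := mul_le_mul_of_nonneg_left hzz hR.le
    have := mul_le_mul_of_nonneg_right this (by positivity : (0 : ℝ) ≤ 2 * v)
    nlinarith
  clear hid hw ht hz hzz
  -- `v ≤ |r| E`, `E = σ₂ + S`, `S = √(σ₂² + 1)`
  set S : ℝ := Real.sqrt (σ₂ ^ 2 + 1) with hS
  have hS2 : S ^ 2 = σ₂ ^ 2 + 1 := Real.sq_sqrt (by positivity)
  have hS0 : 0 ≤ S := Real.sqrt_nonneg _
  set E : ℝ := σ₂ + S with hE
  have hE0 : 0 ≤ E := by positivity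
  have hr2 : r ^ 2 = |r| ^ 2 := (sq_abs r).symm
  have hQ := (abs_le.mp hA).2
  have h1 : v ^ 2 ≤ |r| ^ 2 + 2 * |r| * σ₂ * v := by nlinarith [sq_nonneg (w.re - m)]
  have hvE : v ≤ |r| * E := by
    have h2 : (v - |r| * σ₂) ^ 2 ≤ (|r| * S) ^ 2 := by
      have e1 : (v - |r| * σ₂) ^ 2 = v ^ 2 - 2 * |r| * σ₂ * v + |r| ^ 2 * σ₂ ^ 2 := by ring
      have e2 : (|r| * S) ^ 2 = |r| ^ 2 * σ₂ ^ 2 + |r| ^ 2 := by rw [mul_pow, hS2]; ring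
      rw [e1, e2]
      linarith
    have h3 := (abs_le_of_sq_le_sq' h2 (by positivity)).2
    rw [hE, mul_add]
    linarith
  -- `|w.re - m| ≤ |r| (1 + σ₂E)`
  have hσv : σ₂ * v ≤ σ₂ * (|r| * E) := mul_le_mul_of_nonneg_left hvE hσ₂
  have hwm : |w.re - m| ≤ |r| * (1 + σ₂ * E) := by
    have h2 : (w.re - m) ^ 2 ≤ (|r| * (1 + σ₂ * E)) ^ 2 := by
      have e2 : (|r| * (1 + σ₂ * E)) ^ 2 = |r| ^ 2 + 2 * |r| * (|r| * (σ₂ * E)) + |r| ^ 2 * (σ₂ * E) ^ 2 := by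
        ring
      have h3 : (w.re - m) ^ 2 ≤ |r| ^ 2 + 2 * |r| * σ₂ * v := by nlinarith [sq_nonneg v]
      have h4 : 2 * |r| * σ₂ * v ≤ 2 * |r| * (|r| * (σ₂ * E)) := by
        have := mul_le_mul_of_nonneg_left hσv (by positivity : (0 : ℝ) ≤ 2 * |r|)
        linarith [this]
      have h5 : 0 ≤ |r| ^ 2 * (σ₂ * E) ^ 2 := by positivity
      rw [e2]
      linarith
    exact abs_le.mpr (abs_le_of_sq_le_sq' h2 (by positivity))
  -- `|m| ≤ |w.re| + |w.re - m| ≤ σ₁|r|E + |r|(1 + σ₂E)`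
  have hσv₁ : σ₁ * v ≤ σ₁ * (|r| * E) := mul_le_mul_of_nonneg_left hvE hσ₁
  have hm_le : |m| ≤ |r| * (1 + (σ₁ + σ₂) * E) := by
    have h1 : |m| ≤ |w.re| + |w.re - m| := by
      calc |m| = |w.re - (w.re - m)| := by ring_nf
        _ ≤ |w.re| + |w.re - m| := abs_sub _ _
    have h2 : |w.re| ≤ σ₁ * (|r| * E) := hBz.trans hσv₁
    calc |m| ≤ σ₁ * (|r| * E) + |r| * (1 + σ₂ * E) := by linarith
      _ = |r| * (1 + (σ₁ + σ₂) * E) := by ring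
  -- `|bc| = |e₁|/(2|r|)`, `e₁ = b/d = m - r`
  have he₁ : B 0 1 / B 1 1 = m - r := by
    rw [hm, hr]
    field_simp
    linear_combination -hdet
  have e : B 0 1 * B 1 0 = (m - r) / (2 * r) := by
    rw [← he₁, hr]
    field_simp
  rw [e, abs_div, abs_mul, abs_two, div_le_iff₀ (by positivity)]
  calc |m - r| ≤ |m| + |r| := abs_sub _ _
    _ ≤ |r| * (1 + (σ₁ + σ₂) * E) + |r| := by linarith
    _ = (1 + (σ₁ + σ₂) * (σ₂ + S) / 2) * (2 * |r|) := by rw [hE]; ring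

/-- **The collar lemma (precise invariance).** Let `Γ'` be discrete, `D = diag(l, l⁻¹) ∈ Γ'`,
`l² ≠ 1`, `μ = tr²D - 4`, and `σ ≥ 0` with `μ(3 + 3σ²) < 1`. If `B ∈ Γ'` maps a point of the
collar `{|Re z| ≤ σ Im z}` into the collar then `B` preserves the axis `iℝ₊` (`B` is diagonal or
antidiagonal). Proof: the image geodesic `B(iℝ₊) = (e₁, e₂)` passes, like `iℝ₊`, within
`sinh⁻¹σ` of `w = Bz` (the isometry identity), which bounds `|bc| = |e₁|/|e₁ - e₂| ≤ 2 + 3σ²`, and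
Jørgensen's quantity `μ(1 + |bc|) < 1` forces `B` to fix or exchange `0, ∞`.
[cite: Beardon1983, Thm 5.4.1] [cite: Jorgensen1976, Lemma 1] -/
theorem collar_precisely_invariant
    (hΓ : Γ ≤ (Matrix.SpecialLinearGroup.toGL : SL(2, ℝ) →* GL (Fin 2) ℝ).range)
    (hd : IsDiscreteSubgroup Γ) {D B : SL(2, ℝ)}
    (hD : (Matrix.SpecialLinearGroup.toGL D : GL (Fin 2) ℝ) ∈ Γ)
    (hB : (Matrix.SpecialLinearGroup.toGL B : GL (Fin 2) ℝ) ∈ Γ)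
    (h01 : D 0 1 = 0) (h10 : D 1 0 = 0) (hl : D 0 0 ^ 2 ≠ 1)
    {σ : ℝ} (hσ : 0 ≤ σ) (hJ : ((D 0 0 + D 1 1) ^ 2 - 4) * (3 + 3 * σ ^ 2) < 1)
    {z : ℍ} (hz : z ∈ collar σ) (hBz : B • z ∈ collar σ) :
    (B 0 1 = 0 ∧ B 1 0 = 0) ∨ (B 0 0 = 0 ∧ B 1 1 = 0) := by
  by_cases h0 : B 0 0 = 0 ∨ B 0 1 = 0 ∨ B 1 0 = 0 ∨ B 1 1 = 0
  · exact diag_or_antidiag_of_entry_eq_zero hΓ hd hD hB h01 h10 hl h0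
  push Not at h0
  obtain ⟨-, -, hc, hdd⟩ := h0
  have hK := abs_mul_le_of_collars B hc hdd hσ hσ hz hBz
  -- `1 + σ(σ + S) ≤ 2 + 3σ²` with `S = √(σ²+1)`, `2σS ≤ σ² + S²`
  set S : ℝ := Real.sqrt (σ ^ 2 + 1) with hS
  have hS2 : S ^ 2 = σ ^ 2 + 1 := Real.sq_sqrt (by positivity)
  have h2 : 2 * σ * S ≤ σ ^ 2 + S ^ 2 := two_mul_le_add_sq σ S
  have hbc : |B 0 1 * B 1 0| ≤ 2 + 3 * σ ^ 2 := by
    have : (σ + σ) * (σ + S) / 2 = σ ^ 2 + σ * S := by ring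
    rw [this] at hK
    nlinarith
  -- Jørgensen
  apply jorgensen_hyperbolic_diag hΓ hd hD hB h01 h10 hl
  rw [jorgensenJ_diag_eq h01 h10, ← trace_sq_diag_sub_four h01]
  have hμ0 : 0 ≤ (D 0 0 + D 1 1) ^ 2 - 4 := by rw [trace_sq_diag_sub_four h01]; exact sq_nonneg _
  calc ((D 0 0 + D 1 1) ^ 2 - 4) * (1 + |B 0 1 * B 1 0|) ≤ ((D 0 0 + D 1 1) ^ 2 - 4) * (3 + 3 * σ ^ 2) := by
        apply mul_le_mul_of_nonneg_left _ hμ0; linarith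
    _ < 1 := hJ

end Invariance

/-! ## 4. Collars of different axes do not meet -/

section Cross

/-- **Cross-class disjointness (frame form).** Let `Γ'` be discrete with `D₁ = diag ∈ Γ'`
(`μ₁ = tr²D₁ - 4`), and let `H = gD₂g⁻¹ ∈ Γ'` be another hyperbolic element (`μ₂ = tr²D₂ - 4`) with
axis `g(iℝ₊)`. If the collars `{|Re z| ≤ σ₁ Im z}` of `iℝ₊` and `g{|Re z| ≤ σ₂ Im z}` of `g(iℝ₊)`
meet, where `1 ≤ σ₂ ≤ σ₁` and `μ₁(1 + 20(σ₁σ₂)²μ₂) < 1`, then the axes coincide: `g` is diagonal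
or antidiagonal. (Jørgensen for the pair `(D₁, H)`: `J = μ₁(1 + |pqrs|μ₂)` for `g = (p q; r s)`,
and the frame-change estimate bounds `|qr| ≤ 4σ₁σ₂`, `|ps| ≤ 1 + |qr|`.)
[cite: Beardon1983, Thm 5.4.1] [cite: Jorgensen1976, Lemma 1] -/
theorem cross_collar
    (hΓ : Γ ≤ (Matrix.SpecialLinearGroup.toGL : SL(2, ℝ) →* GL (Fin 2) ℝ).range)
    (hd : IsDiscreteSubgroup Γ) {D₁ D₂ g : SL(2, ℝ)}
    (hD₁ : (Matrix.SpecialLinearGroup.toGL D₁ : GL (Fin 2) ℝ) ∈ Γ)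
    (h₁01 : D₁ 0 1 = 0) (h₁10 : D₁ 1 0 = 0) (hl₁ : D₁ 0 0 ^ 2 ≠ 1)
    (h₂01 : D₂ 0 1 = 0) (h₂10 : D₂ 1 0 = 0) (hl₂ : D₂ 0 0 ^ 2 ≠ 1)
    (hH : (Matrix.SpecialLinearGroup.toGL (g * D₂ * g⁻¹) : GL (Fin 2) ℝ) ∈ Γ)
    {σ₁ σ₂ : ℝ} (h12 : σ₂ ≤ σ₁) (hσ₂ : 1 ≤ σ₂)
    (hJ : ((D₁ 0 0 + D₁ 1 1) ^ 2 - 4) * (1 + 20 * (σ₁ * σ₂) ^ 2 * ((D₂ 0 0 + D₂ 1 1) ^ 2 - 4)) < 1)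
    {z : ℍ} (hz : z ∈ collar σ₂) (hgz : g • z ∈ collar σ₁) :
    (g 0 1 = 0 ∧ g 1 0 = 0) ∨ (g 0 0 = 0 ∧ g 1 1 = 0) := by
  have hdetg := det_rel g
  have hlm₂ := diag_ne_of_sq_ne_one h₂01 hl₂
  have hsub₂ : D₂ 1 1 - D₂ 0 0 ≠ 0 := sub_ne_zero.mpr (Ne.symm hlm₂)
  set H : SL(2, ℝ) := g * D₂ * g⁻¹ with hHdef
  obtain ⟨c00, c01, c10, c11⟩ := conj_diag_apply h₂01 h₂10 g
  have hμ₁ : 0 ≤ (D₁ 0 0 + D₁ 1 1) ^ 2 - 4 := by rw [trace_sq_diag_sub_four h₁01]; exact sq_nonneg _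
  have hμ₂ : 0 ≤ (D₂ 0 0 + D₂ 1 1) ^ 2 - 4 := by rw [trace_sq_diag_sub_four h₂01]; exact sq_nonneg _
  -- Step 1: `H` is diagonal
  have hdiag : H 0 1 = 0 ∧ H 1 0 = 0 := by
    by_cases hg : g 1 0 * g 1 1 = 0
    · have hH10 : H 1 0 = 0 := by rw [c10, hg, zero_mul]
      exact ⟨apply_01_eq_zero_of_upper hΓ hd hD₁ hH h₁01 h₁10 hl₁ hH10, hH10⟩
    · have hc : g 1 0 ≠ 0 := fun h => hg (by rw [h, zero_mul])
      have hdd : g 1 1 ≠ 0 := fun h => hg (by rw [h, mul_zero])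
      -- the frame-change estimate
      have hK := abs_mul_le_of_collars g hc hdd (by linarith) (by linarith) hz hgz
      set P : ℝ := σ₁ * σ₂ with hP
      have hP1 : 1 ≤ P := by rw [hP]; nlinarith
      have hS : Real.sqrt (σ₂ ^ 2 + 1) ≤ σ₂ + 1 := by
        rw [Real.sqrt_le_left (by linarith)]
        nlinarith
      have hK4 : |g 0 1 * g 1 0| ≤ 4 * P := by
        have h1 : (σ₁ + σ₂) * (σ₂ + Real.sqrt (σ₂ ^ 2 + 1)) ≤ (2 * σ₁) * (3 * σ₂) := by
          apply mul_le_mul (by linarith) (by linarith) (by positivity) (by linarith)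
        rw [hP]
        linarith
      have hps : |g 0 0 * g 1 1| ≤ 1 + 4 * P := by
        have : g 0 0 * g 1 1 = 1 + g 0 1 * g 1 0 := by linarith
        rw [this]
        calc |1 + g 0 1 * g 1 0| ≤ |(1 : ℝ)| + |g 0 1 * g 1 0| := abs_add_le _ _
          _ ≤ 1 + 4 * P := by rw [abs_one]; linarith
      -- Jørgensen for `(D₁, H)`
      have hHH : |H 0 1 * H 1 0| ≤ 20 * P ^ 2 * ((D₂ 0 0 + D₂ 1 1) ^ 2 - 4) := by
        have e : H 0 1 * H 1 0 = -(g 0 0 * g 1 1) * (g 0 1 * g 1 0) * ((D₂ 0 0 + D₂ 1 1) ^ 2 - 4) := by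
          rw [c01, c10, trace_sq_diag_sub_four h₂01]; ring
        rw [e, abs_mul, abs_mul, abs_neg, abs_of_nonneg hμ₂]
        have := mul_le_mul hps hK4 (abs_nonneg _) (by positivity)
        have h20 : (1 + 4 * P) * (4 * P) ≤ 20 * P ^ 2 := by nlinarith
        calc |g 0 0 * g 1 1| * |g 0 1 * g 1 0| * ((D₂ 0 0 + D₂ 1 1) ^ 2 - 4)
            ≤ (1 + 4 * P) * (4 * P) * ((D₂ 0 0 + D₂ 1 1) ^ 2 - 4) := by gcongr
          _ ≤ 20 * P ^ 2 * ((D₂ 0 0 + D₂ 1 1) ^ 2 - 4) := by gcongr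
      have hJ' : |(D₁ 0 0 + D₁ 1 1) ^ 2 - 4| + |(D₁ * H * D₁⁻¹ * H⁻¹) 0 0 + (D₁ * H * D₁⁻¹ * H⁻¹) 1 1 - 2| < 1 := by
        rw [jorgensenJ_diag_eq h₁01 h₁10, ← trace_sq_diag_sub_four h₁01]
        calc ((D₁ 0 0 + D₁ 1 1) ^ 2 - 4) * (1 + |H 0 1 * H 1 0|)
            ≤ ((D₁ 0 0 + D₁ 1 1) ^ 2 - 4) * (1 + 20 * (σ₁ * σ₂) ^ 2 * ((D₂ 0 0 + D₂ 1 1) ^ 2 - 4)) := by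
              apply mul_le_mul_of_nonneg_left _ hμ₁; rw [← hP]; linarith
          _ < 1 := hJ
      rcases jorgensen_hyperbolic_diag hΓ hd hD₁ hH h₁01 h₁10 hl₁ hJ' with h | ⟨h00, h11⟩
      · exact h
      · -- antidiagonal is impossible: `tr H = tr D₂ ≠ 0`
        exfalso
        have htr : H 0 0 + H 1 1 = D₂ 0 0 + D₂ 1 1 := by
          have := trace_conj_eq g⁻¹ D₂
          rw [inv_inv] at this
          exact this
        rw [h00, h11, zero_add] at htr
        have h4 : (D₂ 0 0 + D₂ 1 1) ^ 2 - 4 = (D₂ 0 0 - D₂ 1 1) ^ 2 := trace_sq_diag_sub_four h₂01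
        rw [← htr] at h4
        have h5 := sq_nonneg (D₂ 0 0 - D₂ 1 1)
        rw [← h4] at h5
        norm_num at h5
  -- Step 2: `g` preserves `{0, ∞}`
  obtain ⟨hH01, hH10⟩ := hdiag
  rw [c01] at hH01
  rw [c10] at hH10
  have hsub₂' : D₂ 0 0 - D₂ 1 1 ≠ 0 := sub_ne_zero.mpr hlm₂
  have h1 : g 0 0 * g 0 1 = 0 := by
    rcases mul_eq_zero.mp hH01 with h | h
    · exact h
    · exact absurd h hsub₂
  have h2 : g 1 0 * g 1 1 = 0 := by
    rcases mul_eq_zero.mp hH10 with h | h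
    · exact h
    · exact absurd h hsub₂'
  rcases mul_eq_zero.mp h1 with h00 | h01
  · right
    refine ⟨h00, ?_⟩
    rcases mul_eq_zero.mp h2 with h10 | h11
    · exfalso; rw [h00, h10] at hdetg; linarith
    · exact h11
  · left
    refine ⟨h01, ?_⟩
    rcases mul_eq_zero.mp h2 with h10 | h11
    · exact h10
    · exfalso; rw [h01, h11] at hdetg; linarith

end Cross

/-! ## 5. Counting short geodesics by unfolding; the positive systole -/

section Systole

/-- The radius parameter of the test discs, `ρ₀ = 1/5000`. [folklore] -/
def discRadius : ℝ := 1 / 5000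

/-- The base point `σ/2 + i` of the test disc in the frame of an axis: half-way out in the collar
`{|Re z| ≤ σ Im z}`. [folklore] -/
def basePt (σ : ℝ) : ℍ := ⟨(σ / 2 : ℝ) + Complex.I, by simp⟩

/-- Real part of the base point. [folklore] -/
@[simp] theorem basePt_re (σ : ℝ) : (basePt σ).re = σ / 2 := by simp [basePt, UpperHalfPlane.re]

/-- Imaginary part of the base point. [folklore] -/
@[simp] theorem basePt_im (σ : ℝ) : (basePt σ).im = 1 := by simp [basePt, UpperHalfPlane.im]

/-- **The test disc lies in the collar**: `{u(σ/2 + i, ·) ≤ ρ₀} ⊆ {|Re z| ≤ σ Im z}` for `σ ≥ 1`.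
[folklore] -/
theorem uDisc_basePt_subset_collar {σ : ℝ} (hσ : 1 ≤ σ) : uDisc (basePt σ) discRadius ⊆ collar σ := by
  intro z hz
  rw [mem_uDisc_iff, pointPairInv, Complex.dist_eq, Complex.sq_norm, Complex.normSq_apply] at hz
  simp only [Complex.sub_re, Complex.sub_im, UpperHalfPlane.coe_re, UpperHalfPlane.coe_im, basePt_re,
    basePt_im, discRadius] at hz
  rw [mem_collar_iff]
  have hy := z.im_pos
  rw [div_le_iff₀ (by positivity)] at hz
  -- `(y - 1)² ≤ 4ρ₀ y` forces `y ≤ 2`, then `|y - 1| ≤ 1/25` and `|x - σ/2| ≤ 1/25`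
  have h1 : (1 - z.im) * (1 - z.im) ≤ 1 / 5000 * (4 * 1 * z.im) := by nlinarith [mul_self_nonneg (σ / 2 - z.re)]
  have hy2 : z.im ≤ 2 := by nlinarith
  have hy1 : 24 / 25 ≤ z.im := by nlinarith
  have hx : (σ / 2 - z.re) * (σ / 2 - z.re) ≤ (1 / 25) ^ 2 := by nlinarith [mul_self_nonneg (1 - z.im)]
  have hx' : |σ / 2 - z.re| ≤ 1 / 25 := abs_le_of_sq_le_sq' (by nlinarith) (by norm_num) |> abs_le.mpr
  rw [abs_le] at hx' ⊢
  constructor <;> nlinarith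

/-- **Displacement of a dilation at the base point**: for diagonal `E`,
`u(p, Ep) ≥ (tr²E - 4) σ²/16` at `p = σ/2 + i`. [cite: Beardon1983, Thm 5.4.1] -/
theorem pointPairInv_basePt_diag {E : SL(2, ℝ)} (h01 : E 0 1 = 0) (h10 : E 1 0 = 0) (σ : ℝ) :
    ((E 0 0 + E 1 1) ^ 2 - 4) * σ ^ 2 / 16 ≤ pointPairInv (basePt σ) (E • basePt σ) := by
  rw [pointPairInv_diag_smul h01 h10, basePt_re, basePt_im, div_one]
  have hμ : 0 ≤ (E 0 0 + E 1 1) ^ 2 - 4 := by rw [trace_sq_diag_sub_four h01]; exact sq_nonneg _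
  nlinarith [sq_nonneg σ]

/-- A half-turn about a point of the axis (an antidiagonal element) maps `z` to a point `w` on the
other side with the same slope: `Re w · Im z = -Im w · Re z`. [folklore] -/
theorem antidiag_smul_re {E : SL(2, ℝ)} (h00 : E 0 0 = 0) (h11 : E 1 1 = 0) (z : ℍ) :
    (E • z).re * z.im = -((E • z).im * z.re) := by
  have hdet := det_rel E
  rw [h00, h11, zero_mul, zero_sub] at hdet
  -- `w · z = b/c` is real
  have hc : (E 1 0 : ℝ) ≠ 0 := fun h => by rw [h, mul_zero, neg_zero] at hdet; exact zero_ne_one hdet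
  have hz : (z : ℂ) ≠ 0 := z.ne_zero
  have e : ((E • z : ℍ) : ℂ) * (z : ℂ) = ((E 0 1 / E 1 0 : ℝ) : ℂ) := by
    rw [UpperHalfPlane.coe_specialLinearGroup_apply]
    simp only [Algebra.algebraMap_self, RingHom.id_apply, h00, h11, Complex.ofReal_zero, zero_mul, zero_add,
      add_zero]
    have : (E 1 0 : ℂ) * (z : ℂ) ≠ 0 := mul_ne_zero (by exact_mod_cast hc) hz
    field_simp
    push_cast
    ring
  have him := congrArg Complex.im e
  rw [Complex.mul_im, Complex.ofReal_im, UpperHalfPlane.coe_re, UpperHalfPlane.coe_im, UpperHalfPlane.coe_re,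
    UpperHalfPlane.coe_im] at him
  linarith

/-- **Displacement of a half-turn about an axis point**: `u(z, Ez) ≥ (Re z/Im z)²` for antidiagonal
`E` (the two points lie on opposite sides of the axis at the same distance). [folklore] -/
theorem pointPairInv_antidiag_smul {E : SL(2, ℝ)} (h00 : E 0 0 = 0) (h11 : E 1 1 = 0) (z : ℍ) :
    (z.re / z.im) ^ 2 ≤ pointPairInv z (E • z) := by
  have hrel := antidiag_smul_re h00 h11 z
  generalize hw : E • z = w at hrel
  have hy := z.im_pos
  have hv := w.im_pos
  set s : ℝ := z.re / z.im with hs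
  have hx : z.re = s * z.im := by rw [hs]; field_simp
  have hwre : w.re = -(s * w.im) := by
    rw [hx] at hrel
    have : (w.re + s * w.im) * z.im = 0 := by linarith
    rcases mul_eq_zero.mp this with h | h
    · linarith
    · exact absurd h hy.ne'
  rw [pointPairInv, Complex.dist_eq, Complex.sq_norm, Complex.normSq_apply]
  simp only [Complex.sub_re, Complex.sub_im, UpperHalfPlane.coe_re, UpperHalfPlane.coe_im]
  rw [hx, hwre, le_div_iff₀ (by positivity)]
  nlinarith [sq_nonneg (z.im - w.im), sq_nonneg s, mul_nonneg (sq_nonneg s) (sq_nonneg (z.im - w.im))]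

/-- A diagonal element of `SL₂(ℝ)` with `tr² = 4` is `±1`. [folklore] -/
theorem eq_one_or_neg_one_of_diag {E : SL(2, ℝ)} (h01 : E 0 1 = 0) (h10 : E 1 0 = 0)
    (hμ : (E 0 0 + E 1 1) ^ 2 - 4 = 0) : E = 1 ∨ E = -1 := by
  have hd := diag_mul_eq_one h01
  rw [trace_sq_diag_sub_four h01] at hμ
  have heq : E 0 0 = E 1 1 := by nlinarith
  rw [← heq, ← sq] at hd
  rcases sq_eq_one_iff.mp hd |> fun h => h with h | h
  · left
    ext i j
    fin_cases i <;> fin_cases j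
    · exact h
    · exact h01
    · exact h10
    · show E 1 1 = 1
      rw [← heq, h]
  · right
    ext i j
    fin_cases i <;> fin_cases j
    · simp [Matrix.SpecialLinearGroup.coe_neg, h]
    · simp [Matrix.SpecialLinearGroup.coe_neg, h01]
    · simp [Matrix.SpecialLinearGroup.coe_neg, h10]
    · simp [Matrix.SpecialLinearGroup.coe_neg, ← heq, h]

/-- The width `σ = √((1/64)/μ)` of the collar used for an element with `μ = tr² - 4`
(so that `μσ² = 1/64`). [folklore] -/
def width (D : SL(2, ℝ)) : ℝ := Real.sqrt ((1 / 64) / ((D 0 0 + D 1 1) ^ 2 - 4))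

/-- `μ = tr²D - 4 > 0` for a diagonal `D` with `l² ≠ 1`. [folklore] -/
theorem traceSq_sub_four_pos {D : SL(2, ℝ)} (h01 : D 0 1 = 0) (hl : D 0 0 ^ 2 ≠ 1) :
    0 < (D 0 0 + D 1 1) ^ 2 - 4 := by
  rw [trace_sq_diag_sub_four h01]
  have h2 : D 0 0 - D 1 1 ≠ 0 := sub_ne_zero.mpr (diag_ne_of_sq_ne_one h01 hl)
  exact lt_of_le_of_ne (sq_nonneg _) (Ne.symm (pow_ne_zero 2 h2))

/-- `σ² = (1/64)/μ`. [folklore] -/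
theorem width_sq {D : SL(2, ℝ)} (h01 : D 0 1 = 0) (hl : D 0 0 ^ 2 ≠ 1) :
    width D ^ 2 = (1 / 64) / ((D 0 0 + D 1 1) ^ 2 - 4) :=
  Real.sq_sqrt (div_nonneg (by norm_num) (traceSq_sub_four_pos h01 hl).le)

/-- `μ σ² = 1/64`. [folklore] -/
theorem mu_mul_width_sq {D : SL(2, ℝ)} (h01 : D 0 1 = 0) (hl : D 0 0 ^ 2 ≠ 1) :
    ((D 0 0 + D 1 1) ^ 2 - 4) * width D ^ 2 = 1 / 64 := by
  rw [width_sq h01 hl, mul_div_cancel₀ _ (traceSq_sub_four_pos h01 hl).ne']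

/-- `σ ≥ 1` when `μ ≤ 1/64`. [folklore] -/
theorem one_le_width {D : SL(2, ℝ)} (h01 : D 0 1 = 0) (hl : D 0 0 ^ 2 ≠ 1)
    (hμ : (D 0 0 + D 1 1) ^ 2 - 4 ≤ 1 / 64) : 1 ≤ width D := by
  rw [width]
  apply Real.le_sqrt_of_sq_le
  rw [one_pow, le_div_iff₀ (traceSq_sub_four_pos h01 hl)]
  linarith

/-- **Axis data**: a frame `g` and a diagonal `D` with `gDg⁻¹ ∈ Γ` short (`μ = tr²D - 4 ≤ 1/64`) and of
minimal `μ` among the hyperbolic elements of `Γ` with the same axis `g(iℝ₊)` (the diagonal elements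
of `g⁻¹Γg`). [folklore] -/
def AxisData (Γ : Subgroup (GL (Fin 2) ℝ)) (g D : SL(2, ℝ)) : Prop :=
  (Matrix.SpecialLinearGroup.toGL (g * D * g⁻¹) : GL (Fin 2) ℝ) ∈ Γ ∧ D 0 1 = 0 ∧ D 1 0 = 0 ∧ D 0 0 ^ 2 ≠ 1 ∧
    (D 0 0 + D 1 1) ^ 2 - 4 ≤ 1 / 64 ∧
    ∀ E : SL(2, ℝ), (Matrix.SpecialLinearGroup.toGL (g * E * g⁻¹) : GL (Fin 2) ℝ) ∈ Γ → E 0 1 = 0 → E 1 0 = 0 →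
      (E 0 0 + E 1 1) ^ 2 - 4 = 0 ∨ (D 0 0 + D 1 1) ^ 2 - 4 ≤ (E 0 0 + E 1 1) ^ 2 - 4

/-- The test disc of an axis datum: `g{u(σ/2 + i, ·) ≤ ρ₀}`. [folklore] -/
def axisDisc (g D : SL(2, ℝ)) : Set ℍ :=
  uDisc ((Matrix.SpecialLinearGroup.toGL g : GL (Fin 2) ℝ) • basePt (width D)) discRadius

/-- `ρ₀ > 0`. [folklore] -/
theorem discRadius_pos : 0 < discRadius := by rw [discRadius]; norm_num

/-- The test disc is measurable, of area `4πρ₀`. [folklore] -/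
theorem measurableSet_axisDisc (g D : SL(2, ℝ)) : MeasurableSet (axisDisc g D) :=
  measurableSet_uDisc discRadius_pos.le

/-- The test disc has area `4πρ₀`. [folklore] -/
theorem volume_axisDisc (g D : SL(2, ℝ)) : volume (axisDisc g D) = ENNReal.ofReal (4 * π * discRadius) :=
  volume_uDisc discRadius_pos.le

/-- Frame plumbing: membership in the conjugate group `g⁻¹Γg`. [folklore] -/
theorem toGL_mem_conj_iff (g E : SL(2, ℝ)) :
    (Matrix.SpecialLinearGroup.toGL E : GL (Fin 2) ℝ) ∈
        ConjAct.toConjAct (Matrix.SpecialLinearGroup.toGL g : GL (Fin 2) ℝ)⁻¹ • Γ ↔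
      (Matrix.SpecialLinearGroup.toGL (g * E * g⁻¹) : GL (Fin 2) ℝ) ∈ Γ := by
  rw [mem_conj_inv_iff, map_mul, map_mul, map_inv]

/-- Frame plumbing: the conjugate group `g⁻¹Γg` lies in `SL₂(ℝ)`. [folklore] -/
theorem conj_le_range'
    (hΓ : Γ ≤ (Matrix.SpecialLinearGroup.toGL : SL(2, ℝ) →* GL (Fin 2) ℝ).range) (g : SL(2, ℝ)) :
    ConjAct.toConjAct (Matrix.SpecialLinearGroup.toGL g : GL (Fin 2) ℝ)⁻¹ • Γ ≤
      (Matrix.SpecialLinearGroup.toGL : SL(2, ℝ) →* GL (Fin 2) ℝ).range := by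
  rw [← map_inv]
  exact conj_le_range hΓ g⁻¹

/-- The test disc lies in the (moved) collar. [folklore] -/
theorem axisDisc_subset {g D : SL(2, ℝ)} (h01 : D 0 1 = 0) (hl : D 0 0 ^ 2 ≠ 1)
    (hμ : (D 0 0 + D 1 1) ^ 2 - 4 ≤ 1 / 64) :
    axisDisc g D ⊆ (Matrix.SpecialLinearGroup.toGL g : GL (Fin 2) ℝ) • collar (width D) := by
  rw [axisDisc, ← smul_uDisc ⟨g, rfl⟩]
  exact Set.smul_set_mono (uDisc_basePt_subset_collar (one_le_width h01 hl hμ))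

/-- `4ρ₀(1 + ρ₀) < 1/1024`. [folklore] -/
theorem four_discRadius_lt : 4 * discRadius * (1 + discRadius) < 1 / 1024 := by
  rw [discRadius]; norm_num

/-- **Hits in one class come from `±γ`.** If `γw` and `γ'w` both lie in the test disc of an axis
datum then `γ' = ±γ`: `η = γ'γ⁻¹` maps a collar point into the collar, so preserves the axis
(`collar_precisely_invariant`), and moves the centre by `u ≤ 4ρ₀(1+ρ₀) < 1/1024`; a dilation in the
stabiliser moves it by `≥ μσ²/16 = 1/1024` (minimality of `μ`), a half-turn by `≥ σ²/4`.
[cite: Beardon1983, Thm 5.4.1] -/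
theorem eq_or_eq_neg_of_mem_axisDisc
    (hΓ : Γ ≤ (Matrix.SpecialLinearGroup.toGL : SL(2, ℝ) →* GL (Fin 2) ℝ).range)
    (hd : IsDiscreteSubgroup Γ) {g D : SL(2, ℝ)} (hA : AxisData Γ g D)
    {γ γ' : GL (Fin 2) ℝ} (hγ : γ ∈ Γ) (hγ' : γ' ∈ Γ) {w : ℍ}
    (h1 : γ • w ∈ axisDisc g D) (h2 : γ' • w ∈ axisDisc g D) : γ' = γ ∨ γ' = -γ := by
  obtain ⟨hD, h01, h10, hl, hμ, hmin⟩ := hA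
  have ee : ∀ (x : SL(2, ℝ)) (z : ℍ), (Matrix.SpecialLinearGroup.toGL x : GL (Fin 2) ℝ) • z = x • z :=
    fun x z => rfl
  set G : GL (Fin 2) ℝ := Matrix.SpecialLinearGroup.toGL g with hG
  set σ : ℝ := width D with hσ
  set p : ℍ := basePt σ with hp
  have hσ1 : 1 ≤ σ := one_le_width h01 hl hμ
  -- `η = γ' γ⁻¹`
  set η : GL (Fin 2) ℝ := γ' * γ⁻¹ with hη
  have hηmem : η ∈ Γ := Γ.mul_mem hγ' (Γ.inv_mem hγ)
  have hηw : η • (γ • w) = γ' • w := by rw [hη, mul_smul, inv_smul_smul]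
  obtain ⟨e, he⟩ := hΓ hηmem
  set E : SL(2, ℝ) := g⁻¹ * e * g with hE
  have hgE : g * E * g⁻¹ = e := by rw [hE]; group
  have hEmem : (Matrix.SpecialLinearGroup.toGL (g * E * g⁻¹) : GL (Fin 2) ℝ) ∈ Γ := by rw [hgE, he]; exact hηmem
  -- the frame group
  set Γ' := ConjAct.toConjAct G⁻¹ • Γ with hΓ'
  have hΓ'r := conj_le_range' hΓ g
  have hd' : IsDiscreteSubgroup Γ' := hd.conj _
  have hD' : (Matrix.SpecialLinearGroup.toGL D : GL (Fin 2) ℝ) ∈ Γ' := (toGL_mem_conj_iff g D).mpr hD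
  have hE' : (Matrix.SpecialLinearGroup.toGL E : GL (Fin 2) ℝ) ∈ Γ' := (toGL_mem_conj_iff g E).mpr hEmem
  -- both points in the moved collar; pull back to the frame
  have hsub := axisDisc_subset (g := g) h01 hl hμ
  obtain ⟨z₁, hz₁, hz₁'⟩ := hsub h1
  obtain ⟨z₂, hz₂, hz₂'⟩ := hsub h2
  have hEz : E • z₁ = z₂ := by
    have : (Matrix.SpecialLinearGroup.toGL E : GL (Fin 2) ℝ) • z₁ = z₂ := by
      rw [hE, map_mul, map_mul, map_inv, he, mul_smul, mul_smul]
      have e1 : (Matrix.SpecialLinearGroup.toGL g : GL (Fin 2) ℝ) • z₁ = γ • w := hz₁'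
      have e2 : (Matrix.SpecialLinearGroup.toGL g : GL (Fin 2) ℝ) • z₂ = γ' • w := hz₂'
      rw [e1, hηw, ← e2, inv_smul_smul]
    rwa [ee] at this
  have hPI := collar_precisely_invariant hΓ'r hd' hD' hE' h01 h10 hl (by linarith) (σ := σ)
    (by nlinarith [mu_mul_width_sq h01 hl]) hz₁ (by rw [hEz]; exact hz₂)
  -- displacement of the centre `P = G p`
  have hdisp : pointPairInv p (E • p) < 1 / 1024 := by
    have hu1 : pointPairInv (γ' • w) (G • p) ≤ discRadius := by rw [pointPairInv_comm]; exact h2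
    have hu2 : pointPairInv (γ' • w) (η • G • p) ≤ discRadius := by
      rw [← hηw, ← he, ee, ee, pointPairInv_smul, pointPairInv_comm]
      exact h1
    have h3 := pointPairInv_le_of_le_of_le discRadius_pos.le hu1 hu2
    have e4 : pointPairInv (G • p) (η • G • p) = pointPairInv p (E • p) := by
      rw [← he, ← hgE, map_mul, map_mul, map_inv, mul_smul, mul_smul, inv_smul_smul, hG, ee, ee,
        pointPairInv_smul]
      rfl
    rw [← e4]
    exact h3.trans_lt four_discRadius_lt
  -- the two cases
  have hEpm : E = 1 ∨ E = -1 := by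
    rcases hPI with ⟨hE01, hE10⟩ | ⟨hE00, hE11⟩
    · rcases hmin E hEmem hE01 hE10 with h0 | hle
      · exact eq_one_or_neg_one_of_diag hE01 hE10 h0
      · exfalso
        have hb := pointPairInv_basePt_diag hE01 hE10 σ
        have hw2 := mu_mul_width_sq h01 hl
        have : (1 : ℝ) / 1024 ≤ ((E 0 0 + E 1 1) ^ 2 - 4) * σ ^ 2 / 16 := by nlinarith [sq_nonneg σ]
        linarith
    · exfalso
      have hb := pointPairInv_antidiag_smul hE00 hE11 p
      rw [hp, basePt_re, basePt_im, div_one] at hb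
      have : (1 : ℝ) / 4 ≤ (σ / 2) ^ 2 := by nlinarith
      rw [hp] at hdisp
      linarith
  -- conclude
  have hηpm : η = 1 ∨ η = -1 := by
    rcases hEpm with h | h
    · left
      rw [← he, ← hgE, h, mul_one, mul_inv_cancel, map_one]
    · right
      rw [← he, ← hgE, h]
      simp [toGL_neg]
  rcases hηpm with h | h
  · left
    calc γ' = η * γ := by rw [hη, inv_mul_cancel_right]
      _ = γ := by rw [h, one_mul]
  · right
    calc γ' = η * γ := by rw [hη, inv_mul_cancel_right]
      _ = -γ := by rw [h, neg_one_mul]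

/-- Cross-class step (frame form, `σ₂ ≤ σ₁`): if test discs of two axis data are hit by `γw`
and `γ'w`, then `μ₁ = μ₂` — the axes are `Γ`-equivalent (`cross_collar`), so each `D` is conjugate
into the other's stabiliser, and minimality gives both inequalities. [cite: Beardon1983, Thm 5.4.1] -/
theorem mu_eq_of_mem_axisDisc_aux
    (hΓ : Γ ≤ (Matrix.SpecialLinearGroup.toGL : SL(2, ℝ) →* GL (Fin 2) ℝ).range)
    (hd : IsDiscreteSubgroup Γ) {g₁ D₁ g₂ D₂ : SL(2, ℝ)} (hA₁ : AxisData Γ g₁ D₁) (hA₂ : AxisData Γ g₂ D₂)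
    (h12 : width D₂ ≤ width D₁)
    {γ γ' : GL (Fin 2) ℝ} (hγ : γ ∈ Γ) (hγ' : γ' ∈ Γ) {w : ℍ}
    (h1 : γ • w ∈ axisDisc g₁ D₁) (h2 : γ' • w ∈ axisDisc g₂ D₂) :
    (D₁ 0 0 + D₁ 1 1) ^ 2 - 4 = (D₂ 0 0 + D₂ 1 1) ^ 2 - 4 := by
  obtain ⟨hD₁, h₁01, h₁10, hl₁, hμ₁, hmin₁⟩ := hA₁
  obtain ⟨hD₂, h₂01, h₂10, hl₂, hμ₂, hmin₂⟩ := hA₂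
  have ee : ∀ (x : SL(2, ℝ)) (z : ℍ), (Matrix.SpecialLinearGroup.toGL x : GL (Fin 2) ℝ) • z = x • z :=
    fun x z => rfl
  have hσ₂ : 1 ≤ width D₂ := one_le_width h₂01 hl₂ hμ₂
  -- `η = γ γ'⁻¹` maps `γ'w` to `γw`
  set η : GL (Fin 2) ℝ := γ * γ'⁻¹ with hη
  have hηmem : η ∈ Γ := Γ.mul_mem hγ (Γ.inv_mem hγ')
  have hηw : η • (γ' • w) = γ • w := by rw [hη, mul_smul, inv_smul_smul]
  obtain ⟨e, he⟩ := hΓ hηmem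
  -- pull back: `z ∈ collar σ₂` with `gg • z ∈ collar σ₁`, `gg = g₁⁻¹ e g₂`
  obtain ⟨z₁, hz₁, hz₁'⟩ := axisDisc_subset (g := g₁) h₁01 hl₁ hμ₁ h1
  obtain ⟨z₂, hz₂, hz₂'⟩ := axisDisc_subset (g := g₂) h₂01 hl₂ hμ₂ h2
  set gg : SL(2, ℝ) := g₁⁻¹ * e * g₂ with hgg
  have hggz : gg • z₂ = z₁ := by
    have : (Matrix.SpecialLinearGroup.toGL gg : GL (Fin 2) ℝ) • z₂ = z₁ := by
      rw [hgg, map_mul, map_mul, map_inv, he, mul_smul, mul_smul]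
      have e1 : (Matrix.SpecialLinearGroup.toGL g₁ : GL (Fin 2) ℝ) • z₁ = γ • w := hz₁'
      have e2 : (Matrix.SpecialLinearGroup.toGL g₂ : GL (Fin 2) ℝ) • z₂ = γ' • w := hz₂'
      rw [e2, hηw, ← e1, inv_smul_smul]
    rwa [ee] at this
  -- the frame group of axis 1
  set Γ' := ConjAct.toConjAct (Matrix.SpecialLinearGroup.toGL g₁ : GL (Fin 2) ℝ)⁻¹ • Γ with hΓ'
  have hΓ'r := conj_le_range' hΓ g₁
  have hd' : IsDiscreteSubgroup Γ' := hd.conj _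
  have hD₁' : (Matrix.SpecialLinearGroup.toGL D₁ : GL (Fin 2) ℝ) ∈ Γ' := (toGL_mem_conj_iff g₁ D₁).mpr hD₁
  -- `H = gg D₂ gg⁻¹`: `g₁ H g₁⁻¹ = e (g₂ D₂ g₂⁻¹) e⁻¹ ∈ Γ`
  have hH1 : g₁ * (gg * D₂ * gg⁻¹) * g₁⁻¹ = e * (g₂ * D₂ * g₂⁻¹) * e⁻¹ := by rw [hgg]; group
  have hHmem : (Matrix.SpecialLinearGroup.toGL (g₁ * (gg * D₂ * gg⁻¹) * g₁⁻¹) : GL (Fin 2) ℝ) ∈ Γ := by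
    rw [hH1, map_mul, map_mul, map_inv, he]
    exact Γ.mul_mem (Γ.mul_mem hηmem hD₂) (Γ.inv_mem hηmem)
  have hH' : (Matrix.SpecialLinearGroup.toGL (gg * D₂ * gg⁻¹) : GL (Fin 2) ℝ) ∈ Γ' :=
    (toGL_mem_conj_iff g₁ _).mpr hHmem
  have hw₁ := mu_mul_width_sq h₁01 hl₁
  have hw₂ := mu_mul_width_sq h₂01 hl₂
  have hJ : ((D₁ 0 0 + D₁ 1 1) ^ 2 - 4) * (1 + 20 * (width D₁ * width D₂) ^ 2 * ((D₂ 0 0 + D₂ 1 1) ^ 2 - 4)) < 1 := by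
    have e : ((D₁ 0 0 + D₁ 1 1) ^ 2 - 4) * (1 + 20 * (width D₁ * width D₂) ^ 2 * ((D₂ 0 0 + D₂ 1 1) ^ 2 - 4)) =
        ((D₁ 0 0 + D₁ 1 1) ^ 2 - 4) + 20 * (((D₁ 0 0 + D₁ 1 1) ^ 2 - 4) * width D₁ ^ 2) *
          (((D₂ 0 0 + D₂ 1 1) ^ 2 - 4) * width D₂ ^ 2) := by ring
    rw [e, hw₁, hw₂]
    norm_num
    linarith
  have hgg' := cross_collar hΓ'r hd' hD₁' h₁01 h₁10 hl₁ h₂01 h₂10 hl₂ hH' h12 hσ₂ hJ hz₂ (by rw [hggz]; exact hz₁)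
  -- `H` and `H' = gg⁻¹ D₁ gg` are diagonal
  obtain ⟨-, c01, c10, -⟩ := conj_diag_apply h₂01 h₂10 gg
  obtain ⟨-, c01', c10', -⟩ := conj_diag_apply h₁01 h₁10 gg⁻¹
  obtain ⟨i00, i01, i10, i11⟩ := inv_apply_fin_two gg
  have hzero : gg 0 0 * gg 0 1 = 0 ∧ gg 1 0 * gg 1 1 = 0 := by
    rcases hgg' with ⟨h01, h10⟩ | ⟨h00, h11⟩
    · exact ⟨by rw [h01, mul_zero], by rw [h10, zero_mul]⟩
    · exact ⟨by rw [h00, zero_mul], by rw [h11, mul_zero]⟩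
  have hH01 : (gg * D₂ * gg⁻¹) 0 1 = 0 := by rw [c01, hzero.1, zero_mul]
  have hH10 : (gg * D₂ * gg⁻¹) 1 0 = 0 := by rw [c10, hzero.2, zero_mul]
  have hH'01 : (gg⁻¹ * D₁ * gg⁻¹⁻¹) 0 1 = 0 := by
    rw [c01', i00, i01]
    have : gg 1 1 * -gg 0 1 = -(gg 0 1 * gg 1 1) := by ring
    rcases hgg' with ⟨h01, -⟩ | ⟨-, h11⟩
    · rw [h01]; ring
    · rw [h11]; ring
  have hH'10 : (gg⁻¹ * D₁ * gg⁻¹⁻¹) 1 0 = 0 := by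
    rw [c10', i10, i11]
    rcases hgg' with ⟨-, h10⟩ | ⟨h00, -⟩
    · rw [h10]; ring
    · rw [h00]; ring
  -- traces
  have htrH : (gg * D₂ * gg⁻¹) 0 0 + (gg * D₂ * gg⁻¹) 1 1 = D₂ 0 0 + D₂ 1 1 := by
    have := trace_conj_eq gg⁻¹ D₂; rw [inv_inv] at this; exact this
  have htrH' : (gg⁻¹ * D₁ * gg⁻¹⁻¹) 0 0 + (gg⁻¹ * D₁ * gg⁻¹⁻¹) 1 1 = D₁ 0 0 + D₁ 1 1 := by
    have := trace_conj_eq gg D₁; rw [← inv_inv gg] at this; simpa only [inv_inv] using this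
  have hpos₁ := traceSq_sub_four_pos h₁01 hl₁
  have hpos₂ := traceSq_sub_four_pos h₂01 hl₂
  -- minimality of `D₁` against `H`, of `D₂` against `H'`
  have hle₁ : (D₁ 0 0 + D₁ 1 1) ^ 2 - 4 ≤ (D₂ 0 0 + D₂ 1 1) ^ 2 - 4 := by
    rcases hmin₁ _ hHmem hH01 hH10 with h | h
    · rw [htrH] at h; linarith
    · rw [htrH] at h; exact h
  have hH'mem : (Matrix.SpecialLinearGroup.toGL (g₂ * (gg⁻¹ * D₁ * gg⁻¹⁻¹) * g₂⁻¹) : GL (Fin 2) ℝ) ∈ Γ := by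
    have e1 : g₂ * (gg⁻¹ * D₁ * gg⁻¹⁻¹) * g₂⁻¹ = e⁻¹ * (g₁ * D₁ * g₁⁻¹) * e := by rw [hgg]; group
    rw [e1, map_mul, map_mul, map_inv, he]
    exact Γ.mul_mem (Γ.mul_mem (Γ.inv_mem hηmem) hD₁) hηmem
  have hle₂ : (D₂ 0 0 + D₂ 1 1) ^ 2 - 4 ≤ (D₁ 0 0 + D₁ 1 1) ^ 2 - 4 := by
    rcases hmin₂ _ hH'mem hH'01 hH'10 with h | h
    · rw [htrH'] at h; linarith
    · rw [htrH'] at h; exact h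
  linarith

/-- **Test discs of axis data with different `μ` are never hit together.** [cite: Beardon1983, Thm 5.4.1] -/
theorem mu_eq_of_mem_axisDisc
    (hΓ : Γ ≤ (Matrix.SpecialLinearGroup.toGL : SL(2, ℝ) →* GL (Fin 2) ℝ).range)
    (hd : IsDiscreteSubgroup Γ) {g₁ D₁ g₂ D₂ : SL(2, ℝ)} (hA₁ : AxisData Γ g₁ D₁) (hA₂ : AxisData Γ g₂ D₂)
    {γ γ' : GL (Fin 2) ℝ} (hγ : γ ∈ Γ) (hγ' : γ' ∈ Γ) {w : ℍ}
    (h1 : γ • w ∈ axisDisc g₁ D₁) (h2 : γ' • w ∈ axisDisc g₂ D₂) :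
    (D₁ 0 0 + D₁ 1 1) ^ 2 - 4 = (D₂ 0 0 + D₂ 1 1) ^ 2 - 4 := by
  rcases le_total (width D₂) (width D₁) with h | h
  · exact mu_eq_of_mem_axisDisc_aux hΓ hd hA₁ hA₂ h hγ hγ' h1 h2
  · exact (mu_eq_of_mem_axisDisc_aux hΓ hd hA₂ hA₁ h hγ' hγ h2 h1).symm

variable {N : ℕ} {gs Ds : Fin N → SL(2, ℝ)}

/-- The unfolding weight `Σ_i 𝟙_{B_i}` of a family of test discs. [folklore] -/
def axisWeight (gs Ds : Fin N → SL(2, ℝ)) (z : ℍ) : ℝ≥0∞ :=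
  ∑ i, (axisDisc (gs i) (Ds i)).indicator (fun _ => (1 : ℝ≥0∞)) z

/-- The unfolding weight is measurable. [folklore] -/
theorem measurable_axisWeight (gs Ds : Fin N → SL(2, ℝ)) : Measurable (axisWeight gs Ds) := by
  refine Finset.measurable_sum _ fun i _ => ?_
  exact measurable_const.indicator (measurableSet_axisDisc _ _)

/-- **Multiplicity at most two.** For axis data with pairwise distinct `μ`,
`Σ_{γ ∈ Γ} Σ_i 𝟙_{B_i}(γw) ≤ 2` for every `w`: all hits are in one class (`mu_eq_of_mem_axisDisc`)
and come from `±γ₀` (`eq_or_eq_neg_of_mem_axisDisc`). [cite: Beardon1983, Thm 5.4.1] -/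
theorem tsum_axisWeight_le_two
    (hΓ : Γ ≤ (Matrix.SpecialLinearGroup.toGL : SL(2, ℝ) →* GL (Fin 2) ℝ).range)
    (hd : IsDiscreteSubgroup Γ) (hA : ∀ i, AxisData Γ (gs i) (Ds i))
    (hinj : ∀ i j, (Ds i 0 0 + Ds i 1 1) ^ 2 - 4 = (Ds j 0 0 + Ds j 1 1) ^ 2 - 4 → i = j) (w : ℍ) :
    (∑' γ : Γ, axisWeight gs Ds ((γ : GL (Fin 2) ℝ) • w)) ≤ 2 := by
  classical
  by_cases hex : ∃ (γ : Γ) (i : Fin N), (γ : GL (Fin 2) ℝ) • w ∈ axisDisc (gs i) (Ds i)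
  · obtain ⟨γ₀, i₀, h₀⟩ := hex
    have hcl : ∀ (γ : Γ) (i : Fin N), (γ : GL (Fin 2) ℝ) • w ∈ axisDisc (gs i) (Ds i) →
        i = i₀ ∧ ((γ : GL (Fin 2) ℝ) = γ₀ ∨ (γ : GL (Fin 2) ℝ) = -γ₀) := by
      intro γ i hγ
      have hi : i = i₀ := hinj i i₀ (mu_eq_of_mem_axisDisc hΓ hd (hA i) (hA i₀) γ.2 γ₀.2 hγ h₀)
      subst hi
      exact ⟨rfl, eq_or_eq_neg_of_mem_axisDisc hΓ hd (hA i) γ₀.2 γ.2 h₀ hγ⟩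
    set T : Set Γ := {γ | (γ : GL (Fin 2) ℝ) = γ₀ ∨ (γ : GL (Fin 2) ℝ) = -γ₀} with hT
    have hTcard : T.encard ≤ 2 := by
      have himg : Subtype.val '' T ⊆ ({(γ₀ : GL (Fin 2) ℝ), -(γ₀ : GL (Fin 2) ℝ)} : Set (GL (Fin 2) ℝ)) := by
        rintro x ⟨γ, hγ, rfl⟩
        rcases hγ with h | h
        · rw [h]; exact Set.mem_insert _ _
        · rw [h]; exact Set.mem_insert_of_mem _ rfl
      rw [← Subtype.val_injective.encard_image T]
      calc (Subtype.val '' T).encard ≤ ({(γ₀ : GL (Fin 2) ℝ), -(γ₀ : GL (Fin 2) ℝ)} : Set (GL (Fin 2) ℝ)).encard :=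
            Set.encard_le_encard himg
        _ ≤ ({-(γ₀ : GL (Fin 2) ℝ)} : Set (GL (Fin 2) ℝ)).encard + 1 := Set.encard_insert_le _ _
        _ = 2 := by rw [Set.encard_singleton]; norm_num
    have hφ : ∀ γ : Γ, axisWeight gs Ds ((γ : GL (Fin 2) ℝ) • w) ≤ T.indicator (fun _ => (1 : ℝ≥0∞)) γ := by
      intro γ
      by_cases hT' : γ ∈ T
      · rw [Set.indicator_of_mem hT']
        unfold axisWeight
        calc ∑ i, (axisDisc (gs i) (Ds i)).indicator (fun _ => (1 : ℝ≥0∞)) ((γ : GL (Fin 2) ℝ) • w)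
            ≤ ∑ i, (if i = i₀ then (1 : ℝ≥0∞) else 0) := by
              refine Finset.sum_le_sum fun i _ => ?_
              by_cases hmem : (γ : GL (Fin 2) ℝ) • w ∈ axisDisc (gs i) (Ds i)
              · obtain ⟨rfl, -⟩ := hcl γ i hmem
                rw [Set.indicator_of_mem hmem, if_pos rfl]
              · rw [Set.indicator_of_notMem hmem]
                exact bot_le
          _ = 1 := by rw [Finset.sum_ite_eq' Finset.univ i₀ (fun _ => (1 : ℝ≥0∞))]; simp
      · rw [Set.indicator_of_notMem hT']
        unfold axisWeight
        apply le_of_eq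
        refine Finset.sum_eq_zero fun i _ => ?_
        rw [Set.indicator_apply_eq_zero]
        intro hmem
        exact absurd (hcl γ i hmem).2 hT'
    calc (∑' γ : Γ, axisWeight gs Ds ((γ : GL (Fin 2) ℝ) • w)) ≤ ∑' γ : Γ, T.indicator (fun _ => (1 : ℝ≥0∞)) γ :=
          ENNReal.tsum_le_tsum hφ
      _ = ∑' _ : T, (1 : ℝ≥0∞) := (tsum_subtype T fun _ => (1 : ℝ≥0∞)).symm
      _ = T.encard * 1 := ENNReal.tsum_set_const _ _
      _ ≤ 2 := by rw [mul_one]; exact_mod_cast hTcard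
  · push Not at hex
    have : ∀ γ : Γ, axisWeight gs Ds ((γ : GL (Fin 2) ℝ) • w) = 0 := by
      intro γ
      unfold axisWeight
      refine Finset.sum_eq_zero fun i _ => ?_
      exact Set.indicator_of_notMem (hex γ i) _
    simp [this]

/-- **At most `|F|/(4πρ₀)` classes of short geodesics**: unfolding the weight against the
fundamental domain, `2 N · 4πρ₀ = 2∫φ = ∫_F Σ_γ φ(γw) ≤ 2|F|`.
[cite: Iwaniec2002, §2.2 (Prop. 2.3), PDF pp. 28–29] -/
theorem card_axisData_le
    (hΓ : Γ ≤ (Matrix.SpecialLinearGroup.toGL : SL(2, ℝ) →* GL (Fin 2) ℝ).range)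
    (hneg : -1 ∈ Γ) (hd : IsDiscreteSubgroup Γ) (hF : IsHypFundamentalDomain Γ F)
    (hA : ∀ i, AxisData Γ (gs i) (Ds i))
    (hinj : ∀ i j, (Ds i 0 0 + Ds i 1 1) ^ 2 - 4 = (Ds j 0 0 + Ds j 1 1) ^ 2 - 4 → i = j) :
    (N : ℝ≥0∞) * ENNReal.ofReal (4 * π * discRadius) ≤ volume F := by
  set φ := axisWeight gs Ds with hφ
  have hφm : AEMeasurable φ := (measurable_axisWeight gs Ds).aemeasurable
  have key := setLIntegral_tsum_smul_eq hΓ hneg hd.countable hF hφm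
  have hmass : ∫⁻ z, φ z = (N : ℝ≥0∞) * ENNReal.ofReal (4 * π * discRadius) := by
    rw [hφ]
    unfold axisWeight
    rw [lintegral_finsetSum _ fun i _ => (measurable_const.indicator (measurableSet_axisDisc _ _))]
    simp_rw [lintegral_indicator_const (measurableSet_axisDisc _ _), volume_axisDisc, one_mul]
    simp
  have hle : ∫⁻ w in F, ∑' γ : Γ, φ ((γ : GL (Fin 2) ℝ) • w) ≤ 2 * volume F := by
    calc ∫⁻ w in F, ∑' γ : Γ, φ ((γ : GL (Fin 2) ℝ) • w) ≤ ∫⁻ _w in F, (2 : ℝ≥0∞) :=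
          lintegral_mono fun w => tsum_axisWeight_le_two hΓ hd hA hinj w
      _ = 2 * volume F := setLIntegral_const F 2
  rw [key, hmass] at hle
  have h2 : (2 : ℝ≥0∞) ≠ 0 := two_ne_zero
  have h2' : (2 : ℝ≥0∞) ≠ ⊤ := ENNReal.ofNat_ne_top
  calc (N : ℝ≥0∞) * ENNReal.ofReal (4 * π * discRadius)
      = 2⁻¹ * (2 * ((N : ℝ≥0∞) * ENNReal.ofReal (4 * π * discRadius))) := by
        rw [← mul_assoc, ENNReal.inv_mul_cancel h2 h2', one_mul]
    _ ≤ 2⁻¹ * (2 * volume F) := mul_le_mul_right hle _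
    _ = volume F := by rw [← mul_assoc, ENNReal.inv_mul_cancel h2 h2', one_mul]

/-- A diagonal element with `0 < μ ≤ 1` has entries bounded by `2`. [folklore] -/
theorem abs_apply_le_two_of_diag {E : SL(2, ℝ)} (h01 : E 0 1 = 0) (h10 : E 1 0 = 0)
    (hμ : (E 0 0 + E 1 1) ^ 2 - 4 ≤ 1) : ∀ i j, |E i j| ≤ 2 := by
  have hd := diag_mul_eq_one h01
  rw [trace_sq_diag_sub_four h01] at hμ
  -- `|t - 1/t| ≤ 1` forces `|t| ≤ 2`
  have key : ∀ t s : ℝ, t * s = 1 → (t - s) ^ 2 ≤ 1 → |t| ≤ 2 := by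
    intro t s hts hsq
    have ht2 : t ^ 2 ≤ 2 ^ 2 := by nlinarith [sq_nonneg s]
    exact abs_le.mpr (abs_le_of_sq_le_sq' ht2 (by norm_num))
  intro i j
  fin_cases i <;> fin_cases j
  · exact key _ _ hd hμ
  · show |E 0 1| ≤ 2
    rw [h01, abs_zero]; norm_num
  · show |E 1 0| ≤ 2
    rw [h10, abs_zero]; norm_num
  · show |E 1 1| ≤ 2
    refine key _ _ (by rw [mul_comm]; exact hd) ?_
    rw [← neg_sub, neg_sq]
    exact hμ

/-- **Axis data exist below every short hyperbolic element**: if `γ ∈ Γ` has `4 < tr²γ ≤ 4 + 1/64`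
then some axis datum `(g, D)` has `μ_D ≤ tr²γ - 4` (diagonalise `γ`, then take an element of
minimal `μ` among the finitely many diagonal elements of `g⁻¹Γg` with `0 < μ ≤ μ_γ` — finitely many
by discreteness, their entries being bounded by `2`). [cite: Iwaniec2002, §2.1–2.2, PDF pp. 27–29] -/
theorem exists_axisData
    (hΓ : Γ ≤ (Matrix.SpecialLinearGroup.toGL : SL(2, ℝ) →* GL (Fin 2) ℝ).range)
    (hd : IsDiscreteSubgroup Γ) {γ : GL (Fin 2) ℝ} (hγ : γ ∈ Γ)
    (h4 : 4 < ((γ 0 0 : ℝ) + γ 1 1) ^ 2) (hμ : ((γ 0 0 : ℝ) + γ 1 1) ^ 2 - 4 ≤ 1 / 64) :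
    ∃ g D : SL(2, ℝ), AxisData Γ g D ∧ (D 0 0 + D 1 1) ^ 2 - 4 ≤ ((γ 0 0 : ℝ) + γ 1 1) ^ 2 - 4 := by
  classical
  obtain ⟨e, rfl⟩ := hΓ hγ
  have eij : ∀ i j, ((Matrix.SpecialLinearGroup.toGL e : GL (Fin 2) ℝ) i j : ℝ) = e i j := fun i j => rfl
  simp only [eij] at h4 hμ ⊢
  obtain ⟨g, h01, h10, hl⟩ := exists_conj_diag e h4
  set D₀ : SL(2, ℝ) := g⁻¹ * e * g with hD₀
  have htr₀ : D₀ 0 0 + D₀ 1 1 = e 0 0 + e 1 1 := trace_conj_eq g e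
  have hgD₀ : g * D₀ * g⁻¹ = e := by rw [hD₀]; group
  -- the candidate set
  set C : Set SL(2, ℝ) := {E | (Matrix.SpecialLinearGroup.toGL (g * E * g⁻¹) : GL (Fin 2) ℝ) ∈ Γ ∧
    E 0 1 = 0 ∧ E 1 0 = 0 ∧ 0 < (E 0 0 + E 1 1) ^ 2 - 4 ∧
    (E 0 0 + E 1 1) ^ 2 - 4 ≤ (D₀ 0 0 + D₀ 1 1) ^ 2 - 4} with hC
  have hD₀C : D₀ ∈ C := by
    refine ⟨by rw [hgD₀]; exact hγ, h01, h10, traceSq_sub_four_pos h01 hl, le_rfl⟩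
  -- finiteness via discreteness of the frame group
  have hfin : C.Finite := by
    set Γ' := ConjAct.toConjAct (Matrix.SpecialLinearGroup.toGL g : GL (Fin 2) ℝ)⁻¹ • Γ with hΓ'
    have hd' : IsDiscreteSubgroup Γ' := hd.conj _
    have hfin' := (isDiscreteSubgroup_iff_finite_abs_le.mp hd') 2
    refine (hfin'.preimage (f := fun E : SL(2, ℝ) => (Matrix.SpecialLinearGroup.toGL E : GL (Fin 2) ℝ))
      Matrix.SpecialLinearGroup.toGL_injective.injOn).subset ?_
    rintro E ⟨hE, hE01, hE10, -, hEμ⟩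
    refine ⟨(toGL_mem_conj_iff g E).mpr hE, ?_⟩
    have : (E 0 0 + E 1 1) ^ 2 - 4 ≤ 1 := by rw [htr₀] at hEμ; linarith
    intro i j
    exact abs_apply_le_two_of_diag hE01 hE10 this i j
  -- a minimiser of `μ` on `C`
  obtain ⟨D, hDC, hDmin⟩ := hfin.toFinset.exists_min_image (fun E : SL(2, ℝ) => (E 0 0 + E 1 1) ^ 2 - 4)
    ⟨D₀, hfin.mem_toFinset.mpr hD₀C⟩
  rw [Set.Finite.mem_toFinset] at hDC
  obtain ⟨hD, hD01, hD10, hDpos, hDle⟩ := hDC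
  have hDl : D 0 0 ^ 2 ≠ 1 := by
    intro h1
    rw [trace_sq_diag_sub_four hD01] at hDpos
    have hdd := diag_mul_eq_one hD01
    -- `t² = 1` and `t s = 1` give `s = t`
    have : D 1 1 = D 0 0 := by nlinarith
    rw [this, sub_self] at hDpos
    simp at hDpos
  refine ⟨g, D, ⟨hD, hD01, hD10, hDl, by rw [htr₀] at hDle; linarith, ?_⟩, by rw [htr₀] at hDle; exact hDle⟩
  intro E hE hE01 hE10
  by_cases hE0 : (E 0 0 + E 1 1) ^ 2 - 4 = 0
  · exact Or.inl hE0
  right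
  have hEpos : 0 < (E 0 0 + E 1 1) ^ 2 - 4 := by
    rw [trace_sq_diag_sub_four hE01] at hE0 ⊢
    exact lt_of_le_of_ne (sq_nonneg _) (Ne.symm hE0)
  by_cases hEle : (E 0 0 + E 1 1) ^ 2 - 4 ≤ (D₀ 0 0 + D₀ 1 1) ^ 2 - 4
  · exact hDmin E (hfin.mem_toFinset.mpr ⟨hE, hE01, hE10, hEpos, hEle⟩)
  · push Not at hEle
    linarith

/-- **Positive systole of a finite volume Fuchsian group.** Let `Γ ≤ SL₂(ℝ)` (inside `GL₂(ℝ)`) be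
discrete with `-1 ∈ Γ` and a measurable fundamental domain `F` of finite hyperbolic area. Then the
hyperbolic elements of `Γ` have translation lengths bounded away from zero: there is `η > 0` with
`tr²γ - 4 ≥ η` for every `γ ∈ Γ` with `tr²γ > 4` (`tr²γ - 4 = 4 sinh²(ℓ_γ/2)`). Equivalently `Γ`
has only finitely many classes of primitive hyperbolic elements of length `≤ 1`, a consequence of
Prop. 2.3 (finite volume groups are finitely generated of the first kind); proved here by the
collar/area count `card_axisData_le`. [cite: Iwaniec2002, §2.2 (Prop. 2.3), PDF pp. 28–29] -/
theorem exists_pos_le_traceSq_sub_four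
    (hΓ : Γ ≤ (Matrix.SpecialLinearGroup.toGL : SL(2, ℝ) →* GL (Fin 2) ℝ).range)
    (hneg : -1 ∈ Γ) (hd : IsDiscreteSubgroup Γ) (hF : IsHypFundamentalDomain Γ F) (hvol : volume F < ⊤) :
    ∃ η : ℝ, 0 < η ∧ ∀ γ ∈ Γ, 4 < ((γ 0 0 : ℝ) + γ 1 1) ^ 2 → η ≤ ((γ 0 0 : ℝ) + γ 1 1) ^ 2 - 4 := by
  classical
  by_contra hno
  push Not at hno
  -- `hno : ∀ η > 0, ∃ γ ∈ Γ, 4 < tr² ∧ tr² - 4 < η`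
  -- axis data of strictly decreasing `μ`
  let S := {x : SL(2, ℝ) × SL(2, ℝ) // AxisData Γ x.1 x.2}
  let μ : S → ℝ := fun x => (x.1.2 0 0 + x.1.2 1 1) ^ 2 - 4
  have hμpos : ∀ x : S, 0 < μ x := fun x => traceSq_sub_four_pos x.2.2.1 x.2.2.2.2.1
  have hμle : ∀ x : S, μ x ≤ 1 / 64 := fun x => x.2.2.2.2.2.1
  have step : ∀ x : S, ∃ y : S, μ y < μ x := by
    intro x
    obtain ⟨γ, hγ, h4, hlt⟩ := hno (μ x) (hμpos x)
    obtain ⟨g, D, hA, hle⟩ := exists_axisData hΓ hd hγ h4 (by linarith [hμle x])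
    exact ⟨⟨(g, D), hA⟩, lt_of_le_of_lt hle hlt⟩
  have start : Nonempty S := by
    obtain ⟨γ, hγ, h4, hlt⟩ := hno (1 / 64) (by norm_num)
    obtain ⟨g, D, hA, -⟩ := exists_axisData hΓ hd hγ h4 hlt.le
    exact ⟨⟨(g, D), hA⟩⟩
  choose f hf using step
  obtain ⟨x₀⟩ := start
  set seq : ℕ → S := fun n => f^[n] x₀ with hseq
  have hanti : StrictAnti (μ ∘ seq) := by
    refine strictAnti_nat_of_succ_lt fun n => ?_
    show μ (f^[n + 1] x₀) < μ (f^[n] x₀)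
    rw [Function.iterate_succ_apply']
    exact hf _
  -- `N = ⌊|F|/(4πρ₀)⌋ + 1` of them
  set c : ℝ := 4 * π * discRadius with hc
  have hc0 : 0 < c := by rw [hc]; exact mul_pos (by positivity) discRadius_pos
  set N : ℕ := ⌊(volume F).toReal / c⌋₊ + 1 with hN
  set gs : Fin N → SL(2, ℝ) := fun i => (seq i).1.1 with hgs
  set Ds : Fin N → SL(2, ℝ) := fun i => (seq i).1.2 with hDs
  have hA : ∀ i, AxisData Γ (gs i) (Ds i) := fun i => (seq i).2
  have hinj : ∀ i j : Fin N, (Ds i 0 0 + Ds i 1 1) ^ 2 - 4 = (Ds j 0 0 + Ds j 1 1) ^ 2 - 4 → i = j := by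
    intro i j h
    exact Fin.ext (hanti.injective h)
  have hle := card_axisData_le hΓ hneg hd hF hA hinj
  have hle' : (N : ℝ) * c ≤ (volume F).toReal := by
    have := ENNReal.toReal_mono hvol.ne hle
    rw [ENNReal.toReal_mul, ENNReal.toReal_ofReal hc0.le] at this
    simpa using this
  have hlt : (volume F).toReal / c < N := by
    rw [hN]
    push_cast
    exact Nat.lt_floor_add_one _
  rw [div_lt_iff₀ hc0] at hlt
  linarith

end Systole

end Fuchsian

end Literature.NumberTheory.Automorphic

end
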